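import Literature.Analysis.PDE.FlatDataBounds
import Literature.Analysis.PDE.LatticePartition
import Literature.Analysis.PDE.SymbolFrames
import HarnessLib

/-!
# The flat fine parametrix: the approximate solution operator with `λ`-gain bounds
# (topic `Analysis/PDE`)

Layer (I') of the programme to prove short-time existence for quasilinear strictly parabolic
systems on a closed manifold (hypothesis `hQL` of
`Literature.Geometry.Riemannian.ricciFlow_shortTime_existence_of_quasilinear`). This file packages
the flat fine parametrix (`FlatStep`, `FlatStepEnergy`, `FlatNeumann`, `FlatSup`,
`FlatUniformBounds`, `FlatDataBounds`) into ONE statement, the **flat approximate solution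
operator** `exists_flatApproxSolve`: for coefficient fields `S, 𝔟, 𝔠` on the slab `[0, T] × E'`
that are constant outside a ball, with `S(0, ·)` symmetric and uniformly coercive and with small
temporal oscillation, for every top order `K` and support radius `ϱ` there are constants
`Λ₀, C_box, C_sup` such that every slab-smooth source `Θ` supported in `closedBall 0 ϱ` and every
tolerance `ε > 0` admit slab-smooth `v, r` with

* `v(0) = 0` and `∂ₜ v = L v + Θ - r` on the slab, `L u y = frameOp (S t y) (𝔟 t y) (𝔠 t y) u y`;
* `E_k(r(s)) ≤ ε` for `k + 1 ≤ K`, `s ∈ [0, T]` (the residual is small);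
* the `λ`-GAIN bounds `∫₀ᵗ e^{-2λs} (Σ_a E_k(∂_a v) + E_k(v)) ≤ C_box λ⁻¹ ∫₀ᵗ e^{-2λs} E_k(Θ)` and the
  pointwise bounds `Σ_a E_k(∂_a v(s)) + E_k(v(s)) ≤ C_sup e^{2λs} ∫₀ˢ e^{-2λσ} E_k(Θ)` for all
  `λ ≥ Λ₀`, `k ≤ K` — with constants that do NOT depend on `Θ` or `ε`.

The construction: lattice patches of mesh `δ` (chosen from the modulus of continuity of
`S(0, ·)` so that the adapted symbols are `η`-close to the identity and neighbouring frames are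
nearly isometric), frames normalising `S(0, cᵢ)` (`SymbolFrames`), the finite Neumann iteration
with `N = N(ε)` steps on a region of radius `ϱ + 5 N r`; the bounds for `v = Σ_{m<N} vOne(Θ_m)`
use a weighted Cauchy–Schwarz inequality over `m` (weights `2^{-m}` against the contraction `4^{-m}`)
and the bounded overlap of the pieces, so that they are uniform in `N`. Generic tools proved here:
energies of finite sums with bounded overlap (`sobolevEnergy_sum_le_of_overlap`) and with weights
(`sobolevEnergy_sum_le_weighted`).

Everything is proved; no named fact and no `sorry` is introduced.

## References

* L. Hörmander, *The Analysis of Linear Partial Differential Operators III*, Springer 1985,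
  §17.1 (local parametrices by freezing and patching). [Hormander1985III]
* R. A. Adams, *Sobolev Spaces*, Academic Press 1975, ¶3.1. [Adams1975]
-/

noncomputable section

open Set Function Filter Topology Metric MeasureTheory InnerProductSpace
open scoped ContDiff Topology ENNReal RealInnerProductSpace Laplacian

namespace Literature.Analysis.PDE

open Literature.Analysis.FunctionSpaces Literature.Analysis.FluidPDE TopologicalSpace

section Generic

variable {E : Type*} [NormedAddCommGroup E] [InnerProductSpace ℝ E] [FiniteDimensional ℝ E]
  [MeasurableSpace E] [BorelSpace E]
variable {F : Type*} [NormedAddCommGroup F] [NormedSpace ℝ F]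

/-! ### Finite sums with bounded overlap -/


omit [NormedSpace ℝ F] in
/-- Pointwise: if every sub-family of nonzero vectors has at most `m` members then
`‖Σ_{i ∈ s} aᵢ‖ₑ² ≤ m · Σ_{i ∈ s} ‖aᵢ‖ₑ²`. [folklore] -/
theorem enorm_sum_sq_le_of_card_le {ι : Type*} (s : Finset ι) (a : ι → F) {m : ℝ≥0∞}
    (hm : ∀ t ⊆ s, (∀ i ∈ t, a i ≠ 0) → (t.card : ℝ≥0∞) ≤ m) :
    ‖∑ i ∈ s, a i‖ₑ ^ 2 ≤ m * ∑ i ∈ s, ‖a i‖ₑ ^ 2 := by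
  classical
  set t := s.filter fun i ↦ a i ≠ 0 with ht
  have hsum : ∑ i ∈ s, a i = ∑ i ∈ t, a i := (Finset.sum_filter_ne_zero s).symm
  have hsum2 : ∑ i ∈ t, ‖a i‖ₑ ^ 2 ≤ ∑ i ∈ s, ‖a i‖ₑ ^ 2 :=
    Finset.sum_le_sum_of_subset (Finset.filter_subset _ _)
  have hcard : (t.card : ℝ≥0∞) ≤ m := hm t (Finset.filter_subset _ _) fun i hi ↦ (Finset.mem_filter.1 hi).2
  calc ‖∑ i ∈ s, a i‖ₑ ^ 2 = ‖∑ i ∈ t, a i‖ₑ ^ 2 := by rw [hsum]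
    _ ≤ (t.card : ℝ≥0∞) * ∑ i ∈ t, ‖a i‖ₑ ^ 2 := enorm_sum_sq_le_card t a
    _ ≤ m * ∑ i ∈ s, ‖a i‖ₑ ^ 2 := mul_le_mul' hcard hsum2

omit [NormedSpace ℝ F] in
/-- Order `0`, bounded overlap: if `fᵢ` vanishes off `Bᵢ` and every point lies in at most `m` of
the `Bᵢ` then `∫‖Σ fᵢ‖² ≤ m Σ ∫‖fᵢ‖²`. [folklore] -/
theorem lintegral_enorm_sum_sq_le_of_overlap {ι : Type*} (s : Finset ι) {f : ι → E → F}
    (hf : ∀ i ∈ s, Continuous (f i)) {B : ι → Set E} (hB : ∀ i ∈ s, ∀ x, f i x ≠ 0 → x ∈ B i) {m : ℝ≥0∞}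
    (hm : ∀ x, ∀ t ⊆ s, (∀ i ∈ t, x ∈ B i) → (t.card : ℝ≥0∞) ≤ m) :
    ∫⁻ x, ‖∑ i ∈ s, f i x‖ₑ ^ 2 ≤ m * ∑ i ∈ s, ∫⁻ x, ‖f i x‖ₑ ^ 2 := by
  have hms : ∀ i ∈ s, AEMeasurable (fun x ↦ ‖f i x‖ₑ ^ 2) volume := fun i hi ↦
    ((continuous_enorm.comp (hf i hi)).measurable.pow_const 2).aemeasurable
  calc ∫⁻ x, ‖∑ i ∈ s, f i x‖ₑ ^ 2 ≤ ∫⁻ x, m * ∑ i ∈ s, ‖f i x‖ₑ ^ 2 :=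
        lintegral_mono fun x ↦ enorm_sum_sq_le_of_card_le s (fun i ↦ f i x)
          fun t ht hne ↦ hm x t ht fun i hi ↦ hB i (ht hi) x (hne i hi)
    _ = m * ∑ i ∈ s, ∫⁻ x, ‖f i x‖ₑ ^ 2 := by
        rw [lintegral_const_mul'' _ (Finset.aemeasurable_fun_sum _ hms), lintegral_finsetSum' s hms]

/-- **Finite sums with bounded overlap**: if `tsupport fᵢ ⊆ Bᵢ` and every point lies in at most
`m` of the sets `Bᵢ` then `E_k(Σ_{i ∈ s} fᵢ) ≤ m · Σ_{i ∈ s} E_k(fᵢ)` — the multiplicity `m`, not the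
number of summands, is the constant. [cite: Adams1975, ¶3.1] -/
theorem sobolevEnergy_sum_le_of_overlap (k : ℕ) : ∀ {ι : Type*} (s : Finset ι) {f : ι → E → F}
    (B : ι → Set E), (∀ i ∈ s, ContDiff ℝ k (f i)) → (∀ i ∈ s, tsupport (f i) ⊆ B i) → ∀ {m : ℝ≥0∞},
    (∀ x, ∀ t ⊆ s, (∀ i ∈ t, x ∈ B i) → (t.card : ℝ≥0∞) ≤ m) →
    sobolevEnergy k (fun x ↦ ∑ i ∈ s, f i x) ≤ m * ∑ i ∈ s, sobolevEnergy k (f i) := by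
  induction k with
  | zero =>
    intro ι s f B hf hB m hm
    simp only [sobolevEnergy_zero_left]
    exact lintegral_enorm_sum_sq_le_of_overlap s (fun i hi ↦ (hf i hi).continuous)
      (fun i hi x hx ↦ hB i hi (subset_tsupport _ hx)) hm
  | succ k ih =>
    intro ι s f B hf hB m hm
    rw [sobolevEnergy_succ]
    have hd : ∀ i ∈ s, Differentiable ℝ (f i) := fun i hi ↦ (hf i hi).differentiable (by simp)
    have h0 := lintegral_enorm_sum_sq_le_of_overlap s (fun i hi ↦ (hf i hi).continuous)
      (fun i hi x hx ↦ hB i hi (subset_tsupport _ hx)) hm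
    have h1 : ∀ j, sobolevEnergy k (fun x ↦ fderiv ℝ (fun y ↦ ∑ i ∈ s, f i y) x
        (stdOrthonormalBasis ℝ E j)) ≤ m *
          ∑ i ∈ s, sobolevEnergy k (fun x ↦ fderiv ℝ (f i) x (stdOrthonormalBasis ℝ E j)) := by
      intro j
      have heq : (fun x ↦ fderiv ℝ (fun y ↦ ∑ i ∈ s, f i y) x (stdOrthonormalBasis ℝ E j)) =
          fun x ↦ ∑ i ∈ s, fderiv ℝ (f i) x (stdOrthonormalBasis ℝ E j) := by
        funext x
        rw [fderiv_fun_sum fun i hi ↦ hd i hi x]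
        simp only [FunLike.coe_sum, Finset.sum_apply]
      rw [heq]
      exact ih s B (fun i hi ↦ ((hf i hi).fderiv_right (m := k) (by norm_cast)).clm_apply contDiff_const)
        (fun i hi ↦ (tsupport_fderiv_apply_subset ℝ _).trans (hB i hi)) hm
    calc (∫⁻ x, ‖∑ i ∈ s, f i x‖ₑ ^ 2) + ∑ j, sobolevEnergy k
          (fun x ↦ fderiv ℝ (fun y ↦ ∑ i ∈ s, f i y) x (stdOrthonormalBasis ℝ E j))
        ≤ m * ∑ i ∈ s, (∫⁻ x, ‖f i x‖ₑ ^ 2) + ∑ j, m *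
            ∑ i ∈ s, sobolevEnergy k (fun x ↦ fderiv ℝ (f i) x (stdOrthonormalBasis ℝ E j)) :=
          add_le_add h0 (Finset.sum_le_sum fun j _ ↦ h1 j)
      _ = m * ∑ i ∈ s, sobolevEnergy (k + 1) (f i) := by
          rw [← Finset.mul_sum, ← mul_add, Finset.sum_comm, ← Finset.sum_add_distrib]
          rfl

/-! ### Finite sums with weights (Cauchy–Schwarz) -/

omit [NormedSpace ℝ F] in
/-- Pointwise weighted Cauchy–Schwarz: `‖Σ aᵢ‖ₑ² ≤ (Σ cᵢ) Σ cᵢ⁻¹ ‖aᵢ‖ₑ²` for positive weights.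
[folklore] -/
theorem enorm_sum_sq_le_weighted {ι : Type*} (s : Finset ι) (a : ι → F) {c : ι → ℝ}
    (hc : ∀ i ∈ s, 0 < c i) :
    ‖∑ i ∈ s, a i‖ₑ ^ 2 ≤ ENNReal.ofReal (∑ i ∈ s, c i) * ∑ i ∈ s, ENNReal.ofReal (c i)⁻¹ * ‖a i‖ₑ ^ 2 := by
  have h : ‖∑ i ∈ s, a i‖ ^ 2 ≤ (∑ i ∈ s, c i) * ∑ i ∈ s, (c i)⁻¹ * ‖a i‖ ^ 2 :=
    calc ‖∑ i ∈ s, a i‖ ^ 2 ≤ (∑ i ∈ s, ‖a i‖) ^ 2 := pow_le_pow_left₀ (norm_nonneg _) (norm_sum_le s a) 2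
      _ = (∑ i ∈ s, Real.sqrt (c i) * (‖a i‖ / Real.sqrt (c i))) ^ 2 := by
          congr 1
          refine Finset.sum_congr rfl fun i hi ↦ ?_
          rw [mul_div_cancel₀ _ (Real.sqrt_pos.2 (hc i hi)).ne']
      _ ≤ (∑ i ∈ s, Real.sqrt (c i) ^ 2) * ∑ i ∈ s, (‖a i‖ / Real.sqrt (c i)) ^ 2 :=
          Finset.sum_mul_sq_le_sq_mul_sq s (fun i ↦ Real.sqrt (c i)) (fun i ↦ ‖a i‖ / Real.sqrt (c i))
      _ = (∑ i ∈ s, c i) * ∑ i ∈ s, (c i)⁻¹ * ‖a i‖ ^ 2 := by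
          congr 1
          · exact Finset.sum_congr rfl fun i hi ↦ Real.sq_sqrt (hc i hi).le
          · refine Finset.sum_congr rfl fun i hi ↦ ?_
            rw [div_pow, Real.sq_sqrt (hc i hi).le, div_eq_inv_mul]
  have h1 : ‖∑ i ∈ s, a i‖ₑ ^ 2 = ENNReal.ofReal (‖∑ i ∈ s, a i‖ ^ 2) := by
    rw [← ofReal_norm, ENNReal.ofReal_pow (norm_nonneg _)]
  have h2 : ENNReal.ofReal (∑ i ∈ s, c i) * ∑ i ∈ s, ENNReal.ofReal (c i)⁻¹ * ‖a i‖ₑ ^ 2 =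
      ENNReal.ofReal ((∑ i ∈ s, c i) * ∑ i ∈ s, (c i)⁻¹ * ‖a i‖ ^ 2) := by
    have hc0 : 0 ≤ ∑ i ∈ s, c i := Finset.sum_nonneg fun i hi ↦ (hc i hi).le
    have hterm : ∀ i ∈ s, ENNReal.ofReal (c i)⁻¹ * ‖a i‖ₑ ^ 2 = ENNReal.ofReal ((c i)⁻¹ * ‖a i‖ ^ 2) := by
      intro i hi
      rw [ENNReal.ofReal_mul (inv_nonneg.2 (hc i hi).le), ← ofReal_norm, ENNReal.ofReal_pow (norm_nonneg _)]
    rw [Finset.sum_congr rfl hterm, ← ENNReal.ofReal_sum_of_nonneg (fun i hi ↦ by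
      have := (hc i hi).le; positivity), ← ENNReal.ofReal_mul hc0]
  rw [h1, h2]
  exact ENNReal.ofReal_le_ofReal h

omit [NormedSpace ℝ F] in
/-- Order `0`, weighted. [folklore] -/
theorem lintegral_enorm_sum_sq_le_weighted {ι : Type*} (s : Finset ι) {f : ι → E → F}
    (hf : ∀ i ∈ s, Continuous (f i)) {c : ι → ℝ} (hc : ∀ i ∈ s, 0 < c i) :
    ∫⁻ x, ‖∑ i ∈ s, f i x‖ₑ ^ 2 ≤
      ENNReal.ofReal (∑ i ∈ s, c i) * ∑ i ∈ s, ENNReal.ofReal (c i)⁻¹ * ∫⁻ x, ‖f i x‖ₑ ^ 2 := by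
  have hms : ∀ i ∈ s, AEMeasurable (fun x ↦ ‖f i x‖ₑ ^ 2) volume := fun i hi ↦
    ((continuous_enorm.comp (hf i hi)).measurable.pow_const 2).aemeasurable
  have hms' : ∀ i ∈ s, AEMeasurable (fun x ↦ ENNReal.ofReal (c i)⁻¹ * ‖f i x‖ₑ ^ 2) volume := fun i hi ↦
    (hms i hi).const_mul _
  calc ∫⁻ x, ‖∑ i ∈ s, f i x‖ₑ ^ 2
      ≤ ∫⁻ x, ENNReal.ofReal (∑ i ∈ s, c i) * ∑ i ∈ s, ENNReal.ofReal (c i)⁻¹ * ‖f i x‖ₑ ^ 2 :=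
        lintegral_mono fun x ↦ enorm_sum_sq_le_weighted s (fun i ↦ f i x) hc
    _ = ENNReal.ofReal (∑ i ∈ s, c i) * ∑ i ∈ s, ENNReal.ofReal (c i)⁻¹ * ∫⁻ x, ‖f i x‖ₑ ^ 2 := by
        rw [lintegral_const_mul' _ _ ENNReal.ofReal_ne_top, lintegral_finsetSum' s hms']
        congr 1
        refine Finset.sum_congr rfl fun i hi ↦ ?_
        rw [lintegral_const_mul' _ _ ENNReal.ofReal_ne_top]

/-- **Finite sums with weights**: `E_k(Σ_{i ∈ s} fᵢ) ≤ (Σ cᵢ) · Σ cᵢ⁻¹ E_k(fᵢ)` for positive weights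
`cᵢ` (class `C^k`); with geometric weights this sums geometrically decaying families with a
constant independent of the number of summands. [cite: Adams1975, ¶3.1] -/
theorem sobolevEnergy_sum_le_weighted (k : ℕ) : ∀ {ι : Type*} (s : Finset ι) {f : ι → E → F}
    {c : ι → ℝ}, (∀ i ∈ s, ContDiff ℝ k (f i)) → (∀ i ∈ s, 0 < c i) →
    sobolevEnergy k (fun x ↦ ∑ i ∈ s, f i x) ≤
      ENNReal.ofReal (∑ i ∈ s, c i) * ∑ i ∈ s, ENNReal.ofReal (c i)⁻¹ * sobolevEnergy k (f i) := by
  induction k with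
  | zero =>
    intro ι s f c hf hc
    simp only [sobolevEnergy_zero_left]
    exact lintegral_enorm_sum_sq_le_weighted s (fun i hi ↦ (hf i hi).continuous) hc
  | succ k ih =>
    intro ι s f c hf hc
    rw [sobolevEnergy_succ]
    have hd : ∀ i ∈ s, Differentiable ℝ (f i) := fun i hi ↦ (hf i hi).differentiable (by simp)
    have h0 := lintegral_enorm_sum_sq_le_weighted s (fun i hi ↦ (hf i hi).continuous) hc
    have h1 : ∀ j, sobolevEnergy k (fun x ↦ fderiv ℝ (fun y ↦ ∑ i ∈ s, f i y) x
        (stdOrthonormalBasis ℝ E j)) ≤ ENNReal.ofReal (∑ i ∈ s, c i) *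
          ∑ i ∈ s, ENNReal.ofReal (c i)⁻¹ * sobolevEnergy k (fun x ↦ fderiv ℝ (f i) x (stdOrthonormalBasis ℝ E j)) := by
      intro j
      have heq : (fun x ↦ fderiv ℝ (fun y ↦ ∑ i ∈ s, f i y) x (stdOrthonormalBasis ℝ E j)) =
          fun x ↦ ∑ i ∈ s, fderiv ℝ (f i) x (stdOrthonormalBasis ℝ E j) := by
        funext x
        rw [fderiv_fun_sum fun i hi ↦ hd i hi x]
        simp only [FunLike.coe_sum, Finset.sum_apply]
      rw [heq]
      exact ih s (fun i hi ↦ ((hf i hi).fderiv_right (m := k) (by norm_cast)).clm_apply contDiff_const) hc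
    calc (∫⁻ x, ‖∑ i ∈ s, f i x‖ₑ ^ 2) + ∑ j, sobolevEnergy k
          (fun x ↦ fderiv ℝ (fun y ↦ ∑ i ∈ s, f i y) x (stdOrthonormalBasis ℝ E j))
        ≤ ENNReal.ofReal (∑ i ∈ s, c i) * ∑ i ∈ s, ENNReal.ofReal (c i)⁻¹ * (∫⁻ x, ‖f i x‖ₑ ^ 2) +
          ∑ j, ENNReal.ofReal (∑ i ∈ s, c i) *
            ∑ i ∈ s, ENNReal.ofReal (c i)⁻¹ * sobolevEnergy k (fun x ↦ fderiv ℝ (f i) x (stdOrthonormalBasis ℝ E j)) :=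
          add_le_add h0 (Finset.sum_le_sum fun j _ ↦ h1 j)
      _ = ENNReal.ofReal (∑ i ∈ s, c i) * ∑ i ∈ s, ENNReal.ofReal (c i)⁻¹ * sobolevEnergy (k + 1) (f i) := by
          rw [← Finset.mul_sum, ← mul_add, Finset.sum_comm, ← Finset.sum_add_distrib]
          congr 1
          refine Finset.sum_congr rfl fun i _ ↦ ?_
          rw [sobolevEnergy_succ, mul_add, Finset.mul_sum]

/-- `Σ_a E_k(∂_a f) + E_k(f) ≤ 2 E_{k+1}(f)`. [folklore] -/
theorem sum_sobolevEnergy_fderiv_add_le (k : ℕ) (f : E → F) :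
    (∑ a, sobolevEnergy k (fun x ↦ fderiv ℝ f x (stdOrthonormalBasis ℝ E a))) + sobolevEnergy k f ≤
      2 * sobolevEnergy (k + 1) f := by
  rw [two_mul]
  exact add_le_add (sum_sobolevEnergy_fderiv_le k f) (sobolevEnergy_le_succ k f)


end Generic


/-! ### Supports and overlap of the pieces of one step -/

variable {E' : Type*} [NormedAddCommGroup E'] [InnerProductSpace ℝ E'] [FiniteDimensional ℝ E']
  [MeasurableSpace E'] [BorelSpace E']
variable {F' : Type*} [NormedAddCommGroup F'] [InnerProductSpace ℝ F'] [FiniteDimensional ℝ F']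

namespace FlatStep

variable {ι : Type*} [Fintype ι] (Q : FlatPatches E' ι) (A : ι → E' ≃L[ℝ] E') (T : ℝ)
  (S : ℝ → E' → (E' →L[ℝ] E')) (𝔟 : ℝ → E' → ((E' →L[ℝ] F') →L[ℝ] F')) (𝔠 : ℝ → E' → (F' →L[ℝ] F'))
  (Θ : ℝ → E' → F')


omit [FiniteDimensional ℝ E'] [MeasurableSpace E'] [BorelSpace E'] [FiniteDimensional ℝ F'] in
/-- **Overlap multiplicity of the balls of radius `3r`**: at most `(6r/mesh + 1)ⁿ` of them contain
a given point. [folklore] -/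
theorem card_closedBall_three_le (y : E') (t : Finset ι) (ht : ∀ i ∈ t, y ∈ closedBall (Q.c i) (3 * Q.r)) :
    (t.card : ℝ≥0∞) ≤ ENNReal.ofReal ((2 * (3 * Q.r) / Q.mesh + 1) ^ Module.finrank ℝ E') := by
  rw [← ENNReal.ofReal_natCast]
  exact ENNReal.ofReal_le_ofReal (Q.card_le y (3 * Q.r) (by linarith [Q.r_pos]) t fun i hi ↦
    mem_closedBall.1 (ht i hi))

/-- The pieces vanish off the balls of radius `3r`. [folklore] -/
theorem vPiece_eq_zero {i : ι} (s : ℝ) {y : E'} (hy : y ∉ ball (Q.c i) (3 * Q.r)) : vPiece Q A T Θ i s y = 0 := by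
  simp only [vPiece, vAd, cutAd, psi_psiInv]
  have h : Q.cut i y = 0 := (Q.cut i).zero_of_le_dist (by rw [mem_ball] at hy; exact not_lt.1 hy)
  rw [h, zero_smul]

/-- `tsupport v_i(s) ⊆ closedBall (c i) (3r)`. [folklore] -/
theorem tsupport_vPiece_subset (i : ι) (s : ℝ) : tsupport (vPiece Q A T Θ i s) ⊆ closedBall (Q.c i) (3 * Q.r) := by
  refine (closure_mono fun y hy ↦ ?_).trans closure_ball_subset_closedBall
  by_contra h
  exact hy (vPiece_eq_zero Q A T Θ s h)

/-- The pushed-forward residuals vanish off the closed balls of radius `3r`. [folklore] -/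
theorem errPiece_eq_zero {i : ι} (s : ℝ) {y : E'} (hy : y ∉ closedBall (Q.c i) (3 * Q.r)) :
    errPiece Q A T S 𝔟 𝔠 Θ i s y = 0 := by
  simp only [errPiece, errAd]
  refine flatErr_eq_zero_of_notMem_tsupport _ _ _ _ fun hz ↦ hy ?_
  -- `Ψ⁻¹ y ∈ tsupport (cut ∘ Ψ)` forces `y ∈ tsupport cut = closedBall (c i) (3r)`
  have hc : Continuous (psi Q A i) := (contDiff_psi i).continuous
  have h1 : psi Q A i (psiInv Q A i y) ∈ tsupport (Q.cut i) :=
    hc.closure_preimage_subset (support (Q.cut i)) hz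
  rw [psi_psiInv, (Q.cut i).tsupport_eq] at h1
  exact h1

/-- `tsupport err_i(s) ⊆ closedBall (c i) (3r)`. [folklore] -/
theorem tsupport_errPiece_subset (i : ι) (s : ℝ) :
    tsupport (errPiece Q A T S 𝔟 𝔠 Θ i s) ⊆ closedBall (Q.c i) (3 * Q.r) := by
  refine closure_minimal (fun y hy ↦ ?_) isClosed_closedBall
  by_contra h
  exact hy (errPiece_eq_zero Q A T S 𝔟 𝔠 Θ s h)

/-- The pushed-forward pieces as affine precompositions. [folklore] -/
theorem vPiece_eq_affine (i : ι) (s : ℝ) :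
    vPiece Q A T Θ i s = fun y ↦ vAd Q A T Θ i s ((A i : E' →L[ℝ] E') y + A i (-Q.c i)) := by
  funext y
  simp only [vPiece]
  rw [psiInv_eq_affine]

/-- The pushed-forward residuals as affine precompositions. [folklore] -/
theorem errPiece_eq_affine (i : ι) (s : ℝ) :
    errPiece Q A T S 𝔟 𝔠 Θ i s = fun y ↦ errAd Q A T S 𝔟 𝔠 Θ i s ((A i : E' →L[ℝ] E') y + A i (-Q.c i)) := by
  funext y
  simp only [errPiece]
  rw [psiInv_eq_affine]

/-! ### The engine for the local solutions, one level up on the solution side -/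

variable {Q A T Θ}

/-- **Weighted energies of the local solutions one level up**:
`∫₀ᵗ e^{-2λs} E_{k+1}(w̃_i(s)) ≤ (λ⁻¹/2 + λ⁻²) ∫₀ᵗ e^{-2λs} E_k(Θ̃_i(s))`. [cite: Hormander1985III, §17.1] -/
theorem lintegral_weight_sobolevEnergy_succ_wAd_le (hT : 0 < T) (hΘ : IsSmoothSpaceTimeOn (Icc 0 T) Θ) (k : ℕ)
    (i : ι) {lam : ℝ} (hlam : 0 < lam) {t : ℝ} (ht : t ∈ Icc 0 T) :
    ∫⁻ s in Ioo 0 t, (fun (lam s : ℝ) ↦ ENNReal.ofReal (Real.exp (-2 * lam * s))) lam s * sobolevEnergy (k + 1) (wAd Q A T Θ i s) ≤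
      (ENNReal.ofReal (lam⁻¹ / 2) + ENNReal.ofReal (lam⁻¹ ^ 2)) *
        ∫⁻ s in Ioo 0 t, (fun (lam s : ℝ) ↦ ENNReal.ofReal (Real.exp (-2 * lam * s))) lam s * sobolevEnergy k (dataAd Q A Θ i s) := by
  have hdata := isSmoothSpaceTimeOn_dataAd (Q := Q) (A := A) hΘ i
  have hext := isSpaceTimeTestOn_slabExtend_of_slab hT hdata (isCompact_supportAd i) (dataAd_eq_zero i)
  have hws : IsSmoothSpaceTimeOn (Icc 0 T) (wAd Q A T Θ i) := isSmoothSpaceTimeOn_wAd Q A T Θ hT hΘ i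
  have hWm : Measurable ((fun (lam s : ℝ) ↦ ENNReal.ofReal (Real.exp (-2 * lam * s))) lam) :=
    (Real.continuous_exp.comp (continuous_const.mul continuous_id)).measurable.ennreal_ofReal
  have hd : ∫⁻ s in Ioo 0 t, (fun (lam s : ℝ) ↦ ENNReal.ofReal (Real.exp (-2 * lam * s))) lam s * sobolevEnergy k (slabExtend T (dataAd Q A Θ i) s) =
      ∫⁻ s in Ioo 0 t, (fun (lam s : ℝ) ↦ ENNReal.ofReal (Real.exp (-2 * lam * s))) lam s * sobolevEnergy k (dataAd Q A Θ i s) := by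
    refine setLIntegral_congr_fun measurableSet_Ioo fun s hs ↦ ?_
    simp only
    rw [slabExtend_eq_of_mem ⟨hs.1.le, hs.2.le.trans ht.2⟩]
  -- split `E_{k+1} = ∫‖·‖² + Σ E_k(∂·) ≤ E_k + Σ E_k(∂·)`
  have hsplit : ∀ s, (fun (lam s : ℝ) ↦ ENNReal.ofReal (Real.exp (-2 * lam * s))) lam s * sobolevEnergy (k + 1) (wAd Q A T Θ i s) ≤
      (fun (lam s : ℝ) ↦ ENNReal.ofReal (Real.exp (-2 * lam * s))) lam s * sobolevEnergy k (wAd Q A T Θ i s) +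
        (fun (lam s : ℝ) ↦ ENNReal.ofReal (Real.exp (-2 * lam * s))) lam s * ∑ l, sobolevEnergy k (fun z ↦ fderiv ℝ (wAd Q A T Θ i s) z (stdOrthonormalBasis ℝ E' l)) := by
    intro s
    rw [← mul_add, sobolevEnergy_succ]
    exact mul_le_mul' le_rfl (add_le_add (lintegral_sq_le_sobolevEnergy k _) le_rfl)
  have m1 : AEMeasurable (fun s ↦ (fun (lam s : ℝ) ↦ ENNReal.ofReal (Real.exp (-2 * lam * s))) lam s * sobolevEnergy k (wAd Q A T Θ i s)) (volume.restrict (Ioo 0 t)) :=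
    hWm.aemeasurable.mul (aemeasurable_sobolevEnergy_slice_Ioo' hws k ht.2)
  have h0 : ∫⁻ s in Ioo 0 t, (fun (lam s : ℝ) ↦ ENNReal.ofReal (Real.exp (-2 * lam * s))) lam s * sobolevEnergy k (wAd Q A T Θ i s) ≤
      ENNReal.ofReal (lam⁻¹ ^ 2) * ∫⁻ s in Ioo 0 t, (fun (lam s : ℝ) ↦ ENNReal.ofReal (Real.exp (-2 * lam * s))) lam s * sobolevEnergy k (dataAd Q A Θ i s) := by
    have h := lintegral_weight_sobolevEnergy_heatDuhamelZero_le (E := E') (F' := F') one_pos hlam k hext ht.1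
    rw [hd] at h
    exact h
  have h1 : ∫⁻ s in Ioo 0 t, (fun (lam s : ℝ) ↦ ENNReal.ofReal (Real.exp (-2 * lam * s))) lam s * ∑ l, sobolevEnergy k (fun z ↦ fderiv ℝ (wAd Q A T Θ i s) z
      (stdOrthonormalBasis ℝ E' l)) ≤
      ENNReal.ofReal (lam⁻¹ / 2) * ∫⁻ s in Ioo 0 t, (fun (lam s : ℝ) ↦ ENNReal.ofReal (Real.exp (-2 * lam * s))) lam s * sobolevEnergy k (dataAd Q A Θ i s) := by
    have h := lintegral_weight_sum_sobolevEnergy_fderiv_heatDuhamelZero_le (E := E') (F' := F') one_pos hlam k hext ht.1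
    rw [mul_one, hd] at h
    exact h
  calc ∫⁻ s in Ioo 0 t, (fun (lam s : ℝ) ↦ ENNReal.ofReal (Real.exp (-2 * lam * s))) lam s * sobolevEnergy (k + 1) (wAd Q A T Θ i s)
      ≤ ∫⁻ s in Ioo 0 t, ((fun (lam s : ℝ) ↦ ENNReal.ofReal (Real.exp (-2 * lam * s))) lam s * sobolevEnergy k (wAd Q A T Θ i s) +
          (fun (lam s : ℝ) ↦ ENNReal.ofReal (Real.exp (-2 * lam * s))) lam s * ∑ l, sobolevEnergy k (fun z ↦ fderiv ℝ (wAd Q A T Θ i s) z (stdOrthonormalBasis ℝ E' l))) :=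
        lintegral_mono fun s ↦ hsplit s
    _ = (∫⁻ s in Ioo 0 t, (fun (lam s : ℝ) ↦ ENNReal.ofReal (Real.exp (-2 * lam * s))) lam s * sobolevEnergy k (wAd Q A T Θ i s)) +
          ∫⁻ s in Ioo 0 t, (fun (lam s : ℝ) ↦ ENNReal.ofReal (Real.exp (-2 * lam * s))) lam s * ∑ l, sobolevEnergy k (fun z ↦ fderiv ℝ (wAd Q A T Θ i s) z
            (stdOrthonormalBasis ℝ E' l)) := lintegral_add_left' m1 _
    _ ≤ ENNReal.ofReal (lam⁻¹ ^ 2) * (∫⁻ s in Ioo 0 t, (fun (lam s : ℝ) ↦ ENNReal.ofReal (Real.exp (-2 * lam * s))) lam s * sobolevEnergy k (dataAd Q A Θ i s)) +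
          ENNReal.ofReal (lam⁻¹ / 2) * ∫⁻ s in Ioo 0 t, (fun (lam s : ℝ) ↦ ENNReal.ofReal (Real.exp (-2 * lam * s))) lam s * sobolevEnergy k (dataAd Q A Θ i s) :=
        add_le_add h0 h1
    _ = _ := by ring

/-- **Pointwise-in-time energies of the local solutions one level up**:
`e^{-2λs} E_{k+1}(w̃_i(s)) ≤ (n + λ⁻¹) ∫₀ˢ e^{-2λσ} E_k(Θ̃_i(σ)) dσ`. [cite: Hormander1985III, §17.1] -/
theorem weight_mul_sobolevEnergy_succ_wAd_le (hT : 0 < T) (hΘ : IsSmoothSpaceTimeOn (Icc 0 T) Θ) (k : ℕ)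
    (i : ι) {lam : ℝ} (hlam : 0 < lam) {s : ℝ} (hs : s ∈ Icc 0 T) :
    (fun (lam s : ℝ) ↦ ENNReal.ofReal (Real.exp (-2 * lam * s))) lam s * sobolevEnergy (k + 1) (wAd Q A T Θ i s) ≤
      ((Module.finrank ℝ E' : ℝ≥0∞) + ENNReal.ofReal lam⁻¹) *
        ∫⁻ σ in Ioo 0 s, (fun (lam s : ℝ) ↦ ENNReal.ofReal (Real.exp (-2 * lam * s))) lam σ * sobolevEnergy k (dataAd Q A Θ i σ) := by
  have hdata := isSmoothSpaceTimeOn_dataAd (Q := Q) (A := A) hΘ i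
  have hext := isSpaceTimeTestOn_slabExtend_of_slab hT hdata (isCompact_supportAd i) (dataAd_eq_zero i)
  have hd : ∫⁻ σ in Ioo 0 s, (fun (lam s : ℝ) ↦ ENNReal.ofReal (Real.exp (-2 * lam * s))) lam σ * sobolevEnergy k (slabExtend T (dataAd Q A Θ i) σ) =
      ∫⁻ σ in Ioo 0 s, (fun (lam s : ℝ) ↦ ENNReal.ofReal (Real.exp (-2 * lam * s))) lam σ * sobolevEnergy k (dataAd Q A Θ i σ) := by
    refine setLIntegral_congr_fun measurableSet_Ioo fun σ hσ ↦ ?_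
    simp only
    rw [slabExtend_eq_of_mem ⟨hσ.1.le, hσ.2.le.trans hs.2⟩]
  have h0 : (fun (lam s : ℝ) ↦ ENNReal.ofReal (Real.exp (-2 * lam * s))) lam s * sobolevEnergy k (wAd Q A T Θ i s) ≤
      ENNReal.ofReal lam⁻¹ * ∫⁻ σ in Ioo 0 s, (fun (lam s : ℝ) ↦ ENNReal.ofReal (Real.exp (-2 * lam * s))) lam σ * sobolevEnergy k (dataAd Q A Θ i σ) := by
    have h := weight_mul_sobolevEnergy_heatDuhamelZero_le (E := E') (F' := F') one_pos hlam k hext hs.1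
    rw [hd] at h
    exact h
  have h1 : (fun (lam s : ℝ) ↦ ENNReal.ofReal (Real.exp (-2 * lam * s))) lam s * ∑ l, sobolevEnergy k (fun z ↦ fderiv ℝ (wAd Q A T Θ i s) z (stdOrthonormalBasis ℝ E' l)) ≤
      (Module.finrank ℝ E' : ℝ≥0∞) * ∫⁻ σ in Ioo 0 s, (fun (lam s : ℝ) ↦ ENNReal.ofReal (Real.exp (-2 * lam * s))) lam σ * sobolevEnergy k (dataAd Q A Θ i σ) := by
    have h := weight_mul_sum_sobolevEnergy_fderiv_heatDuhamelZero_le (E := E') (F' := F') one_pos hlam.le k hext hs.1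
    rw [div_one, ENNReal.ofReal_natCast, hd] at h
    exact h
  calc (fun (lam s : ℝ) ↦ ENNReal.ofReal (Real.exp (-2 * lam * s))) lam s * sobolevEnergy (k + 1) (wAd Q A T Θ i s)
      ≤ (fun (lam s : ℝ) ↦ ENNReal.ofReal (Real.exp (-2 * lam * s))) lam s * sobolevEnergy k (wAd Q A T Θ i s) +
          (fun (lam s : ℝ) ↦ ENNReal.ofReal (Real.exp (-2 * lam * s))) lam s * ∑ l, sobolevEnergy k (fun z ↦ fderiv ℝ (wAd Q A T Θ i s) z (stdOrthonormalBasis ℝ E' l)) := by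
        rw [← mul_add, sobolevEnergy_succ]
        exact mul_le_mul' le_rfl (add_le_add (lintegral_sq_le_sobolevEnergy k _) le_rfl)
    _ ≤ ENNReal.ofReal lam⁻¹ * (∫⁻ σ in Ioo 0 s, (fun (lam s : ℝ) ↦ ENNReal.ofReal (Real.exp (-2 * lam * s))) lam σ * sobolevEnergy k (dataAd Q A Θ i σ)) +
          (Module.finrank ℝ E' : ℝ≥0∞) * ∫⁻ σ in Ioo 0 s, (fun (lam s : ℝ) ↦ ENNReal.ofReal (Real.exp (-2 * lam * s))) lam σ * sobolevEnergy k (dataAd Q A Θ i σ) :=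
        add_le_add h0 h1
    _ = _ := by ring

/-! ### Energies of the approximate solution of one step -/

/-- **Energy of one step's approximate solution in terms of the local solutions**: with the
overlap multiplicity `m₃ = (6r/mesh + 1)ⁿ`, a transport constant `Cpush` of the inverse adapted
maps, the crude product constant `Ccr` and a bound `Mv` of the pulled-back cut-offs and their frame
words, `E_j(vOne(s)) ≤ m₃ Cpush Ccr Mv² Σ_i E_j(w̃_i(s))`. [cite: Hormander1985III, §17.1] -/
theorem sobolevEnergy_vOne_le (hT : 0 < T) (hΘ : IsSmoothSpaceTimeOn (Icc 0 T) Θ) (j : ℕ)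
    {Ccr Cpush : ℝ≥0∞} {Mv : ℝ}
    (hcr : ∀ {a : E' → ℝ} {g : E' → F'}, ContDiff ℝ ∞ a → ContDiff ℝ ∞ g → ∀ {M : ℝ}, (∀ x, |a x| ≤ M) →
      (∀ l : List (Fin (Module.finrank ℝ E')), l ≠ [] → l.length ≤ j →
        ∀ x, ‖iterDirDeriv (l.map (stdOrthonormalBasis ℝ E')) a x‖ ≤ M) →
      sobolevEnergy j (fun x ↦ a x • g x) ≤ Ccr * ENNReal.ofReal (M ^ 2) * sobolevEnergy j g)
    (hMv0 : ∀ i z, |cutAd Q A i z| ≤ Mv)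
    (hMvw : ∀ i, ∀ l : List (Fin (Module.finrank ℝ E')), l ≠ [] → l.length ≤ j →
      ∀ z, ‖iterDirDeriv (l.map (stdOrthonormalBasis ℝ E')) (cutAd Q A i) z‖ ≤ Mv)
    (hpush : ∀ i, ENNReal.ofReal (max 1 (‖(A i : E' →L[ℝ] E')‖ ^ 2) ^ j *
      |(LinearMap.det ((A i : E' →L[ℝ] E') : E' →ₗ[ℝ] E'))⁻¹|) ≤ Cpush)
    {s : ℝ} (hs : s ∈ Icc 0 T) :
    sobolevEnergy j (vOne Q A T Θ s) ≤
      ENNReal.ofReal ((2 * (3 * Q.r) / Q.mesh + 1) ^ Module.finrank ℝ E') * (Cpush * (Ccr * ENNReal.ofReal (Mv ^ 2))) *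
        ∑ i, sobolevEnergy j (wAd Q A T Θ i s) := by
  have hws : ∀ i, ContDiff ℝ ∞ (wAd Q A T Θ i s) := fun i ↦ (isSmoothSpaceTimeOn_wAd Q A T Θ hT hΘ i).contDiff_slice hs
  have hva : ∀ i, vAd Q A T Θ i s = fun z ↦ cutAd Q A i z • wAd Q A T Θ i s z := fun i ↦ rfl
  have hvAd : ∀ i, ContDiff ℝ ∞ (vAd Q A T Θ i s) := fun i ↦ by rw [hva]; exact (contDiff_cutAd i).smul (hws i)
  have hv : vOne Q A T Θ s = fun y ↦ ∑ i ∈ Finset.univ, vPiece Q A T Θ i s y := rfl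
  have h1 : sobolevEnergy j (vOne Q A T Θ s) ≤ ENNReal.ofReal ((2 * (3 * Q.r) / Q.mesh + 1) ^ Module.finrank ℝ E') *
      ∑ i, sobolevEnergy j (vPiece Q A T Θ i s) := by
    rw [hv]
    exact sobolevEnergy_sum_le_of_overlap j Finset.univ (fun i ↦ closedBall (Q.c i) (3 * Q.r))
      (fun i _ ↦ (contDiff_vPiece hT hΘ i hs).of_le (by exact_mod_cast le_top))
      (fun i _ ↦ tsupport_vPiece_subset Q A T Θ i s) (fun y t _ ht ↦ card_closedBall_three_le Q y t ht)
  have h2 : ∀ i, sobolevEnergy j (vPiece Q A T Θ i s) ≤ Cpush * (Ccr * ENNReal.ofReal (Mv ^ 2) * sobolevEnergy j (wAd Q A T Θ i s)) := by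
    intro i
    rw [vPiece_eq_affine]
    calc sobolevEnergy j (fun y ↦ vAd Q A T Θ i s ((A i : E' →L[ℝ] E') y + A i (-Q.c i)))
        ≤ Cpush * sobolevEnergy j (vAd Q A T Θ i s) :=
          (sobolevEnergy_comp_affine_le _ (det_frame_ne_zero A i) _ j (hvAd i)).trans (mul_le_mul' (hpush i) le_rfl)
      _ ≤ Cpush * (Ccr * ENNReal.ofReal (Mv ^ 2) * sobolevEnergy j (wAd Q A T Θ i s)) := by
          refine mul_le_mul' le_rfl ?_
          rw [hva]
          exact hcr (contDiff_cutAd i) (hws i) (hMv0 i) (hMvw i)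
  calc sobolevEnergy j (vOne Q A T Θ s)
      ≤ ENNReal.ofReal ((2 * (3 * Q.r) / Q.mesh + 1) ^ Module.finrank ℝ E') * ∑ i, sobolevEnergy j (vPiece Q A T Θ i s) := h1
    _ ≤ ENNReal.ofReal ((2 * (3 * Q.r) / Q.mesh + 1) ^ Module.finrank ℝ E') *
          ∑ i, Cpush * (Ccr * ENNReal.ofReal (Mv ^ 2) * sobolevEnergy j (wAd Q A T Θ i s)) :=
        mul_le_mul' le_rfl (Finset.sum_le_sum fun i _ ↦ h2 i)
    _ = _ := by rw [Finset.mul_sum, Finset.mul_sum]; exact Finset.sum_congr rfl fun i _ ↦ by ring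

/-- **Weighted energies of one step's approximate solution, one level up, with `λ`-gain**:
`∫₀ᵗ e^{-2λs} E_{k+1}(vOne(s)) ≤ m₃ Cpush Ccr Mv² (λ⁻¹/2 + λ⁻²) 𝒩_k(Θ)(t)`,
`𝒩_k(Θ)(t) = Σ_i ∫₀ᵗ e^{-2λs} E_k(Θ̃_i(s))`. [cite: Hormander1985III, §17.1] -/
theorem lintegral_weight_sobolevEnergy_succ_vOne_le (hT : 0 < T) (hΘ : IsSmoothSpaceTimeOn (Icc 0 T) Θ) (k : ℕ)
    {Ccr Cpush : ℝ≥0∞} {Mv : ℝ}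
    (hcr : ∀ {a : E' → ℝ} {g : E' → F'}, ContDiff ℝ ∞ a → ContDiff ℝ ∞ g → ∀ {M : ℝ}, (∀ x, |a x| ≤ M) →
      (∀ l : List (Fin (Module.finrank ℝ E')), l ≠ [] → l.length ≤ k + 1 →
        ∀ x, ‖iterDirDeriv (l.map (stdOrthonormalBasis ℝ E')) a x‖ ≤ M) →
      sobolevEnergy (k + 1) (fun x ↦ a x • g x) ≤ Ccr * ENNReal.ofReal (M ^ 2) * sobolevEnergy (k + 1) g)
    (hMv0 : ∀ i z, |cutAd Q A i z| ≤ Mv)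
    (hMvw : ∀ i, ∀ l : List (Fin (Module.finrank ℝ E')), l ≠ [] → l.length ≤ k + 1 →
      ∀ z, ‖iterDirDeriv (l.map (stdOrthonormalBasis ℝ E')) (cutAd Q A i) z‖ ≤ Mv)
    (hpush : ∀ i, ENNReal.ofReal (max 1 (‖(A i : E' →L[ℝ] E')‖ ^ 2) ^ (k + 1) *
      |(LinearMap.det ((A i : E' →L[ℝ] E') : E' →ₗ[ℝ] E'))⁻¹|) ≤ Cpush)
    {lam : ℝ} (hlam : 0 < lam) {t : ℝ} (ht : t ∈ Icc 0 T) :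
    ∫⁻ s in Ioo 0 t, (fun (lam s : ℝ) ↦ ENNReal.ofReal (Real.exp (-2 * lam * s))) lam s * sobolevEnergy (k + 1) (vOne Q A T Θ s) ≤
      ENNReal.ofReal ((2 * (3 * Q.r) / Q.mesh + 1) ^ Module.finrank ℝ E') * (Cpush * (Ccr * ENNReal.ofReal (Mv ^ 2))) *
        (ENNReal.ofReal (lam⁻¹ / 2) + ENNReal.ofReal (lam⁻¹ ^ 2)) *
        ∑ i, ∫⁻ s in Ioo 0 t, (fun (lam s : ℝ) ↦ ENNReal.ofReal (Real.exp (-2 * lam * s))) lam s * sobolevEnergy k (dataAd Q A Θ i s) := by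
  set C : ℝ≥0∞ := ENNReal.ofReal ((2 * (3 * Q.r) / Q.mesh + 1) ^ Module.finrank ℝ E') *
    (Cpush * (Ccr * ENNReal.ofReal (Mv ^ 2))) with hC
  have hWm : Measurable ((fun (lam s : ℝ) ↦ ENNReal.ofReal (Real.exp (-2 * lam * s))) lam) :=
    (Real.continuous_exp.comp (continuous_const.mul continuous_id)).measurable.ennreal_ofReal
  have hws : ∀ i, IsSmoothSpaceTimeOn (Icc 0 T) (wAd Q A T Θ i) := fun i ↦ isSmoothSpaceTimeOn_wAd Q A T Θ hT hΘ i
  have hpt : ∀ s ∈ Icc 0 T, sobolevEnergy (k + 1) (vOne Q A T Θ s) ≤ C * ∑ i, sobolevEnergy (k + 1) (wAd Q A T Θ i s) :=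
    fun s hs ↦ sobolevEnergy_vOne_le hT hΘ (k + 1) hcr hMv0 hMvw hpush hs
  have mE : ∀ i, AEMeasurable (fun s ↦ (fun (lam s : ℝ) ↦ ENNReal.ofReal (Real.exp (-2 * lam * s))) lam s * sobolevEnergy (k + 1) (wAd Q A T Θ i s)) (volume.restrict (Ioo 0 t)) :=
    fun i ↦ hWm.aemeasurable.mul (aemeasurable_sobolevEnergy_slice_Ioo' (hws i) (k + 1) ht.2)
  calc ∫⁻ s in Ioo 0 t, (fun (lam s : ℝ) ↦ ENNReal.ofReal (Real.exp (-2 * lam * s))) lam s * sobolevEnergy (k + 1) (vOne Q A T Θ s)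
      ≤ ∫⁻ s in Ioo 0 t, (fun (lam s : ℝ) ↦ ENNReal.ofReal (Real.exp (-2 * lam * s))) lam s * (C * ∑ i, sobolevEnergy (k + 1) (wAd Q A T Θ i s)) :=
        setLIntegral_mono' measurableSet_Ioo fun s hs ↦ mul_le_mul' le_rfl (hpt s ⟨hs.1.le, hs.2.le.trans ht.2⟩)
    _ = C * ∑ i, ∫⁻ s in Ioo 0 t, (fun (lam s : ℝ) ↦ ENNReal.ofReal (Real.exp (-2 * lam * s))) lam s * sobolevEnergy (k + 1) (wAd Q A T Θ i s) := by
        have heq : ∀ s, (fun (lam s : ℝ) ↦ ENNReal.ofReal (Real.exp (-2 * lam * s))) lam s * (C * ∑ i, sobolevEnergy (k + 1) (wAd Q A T Θ i s)) =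
            C * ∑ i, (fun (lam s : ℝ) ↦ ENNReal.ofReal (Real.exp (-2 * lam * s))) lam s * sobolevEnergy (k + 1) (wAd Q A T Θ i s) := fun s ↦ by
          rw [Finset.mul_sum, Finset.mul_sum, Finset.mul_sum]
          exact Finset.sum_congr rfl fun i _ ↦ by ring
        simp_rw [heq]
        rw [lintegral_const_mul'' _ (Finset.aemeasurable_fun_sum _ fun i _ ↦ mE i), lintegral_finsetSum' _ fun i _ ↦ mE i]
    _ ≤ C * ∑ i, (ENNReal.ofReal (lam⁻¹ / 2) + ENNReal.ofReal (lam⁻¹ ^ 2)) *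
          ∫⁻ s in Ioo 0 t, (fun (lam s : ℝ) ↦ ENNReal.ofReal (Real.exp (-2 * lam * s))) lam s * sobolevEnergy k (dataAd Q A Θ i s) :=
        mul_le_mul' le_rfl (Finset.sum_le_sum fun i _ ↦ lintegral_weight_sobolevEnergy_succ_wAd_le hT hΘ k i hlam ht)
    _ = _ := by rw [← Finset.mul_sum]; ring

/-- **Pointwise-in-time energies of one step's approximate solution, one level up**:
`E_{k+1}(vOne(s)) ≤ e^{2λs} m₃ Cpush Ccr Mv² (n + λ⁻¹) 𝒩_k(Θ)(s)`. [cite: Hormander1985III, §17.1] -/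
theorem sobolevEnergy_succ_vOne_le_exp (hT : 0 < T) (hΘ : IsSmoothSpaceTimeOn (Icc 0 T) Θ) (k : ℕ)
    {Ccr Cpush : ℝ≥0∞} {Mv : ℝ}
    (hcr : ∀ {a : E' → ℝ} {g : E' → F'}, ContDiff ℝ ∞ a → ContDiff ℝ ∞ g → ∀ {M : ℝ}, (∀ x, |a x| ≤ M) →
      (∀ l : List (Fin (Module.finrank ℝ E')), l ≠ [] → l.length ≤ k + 1 →
        ∀ x, ‖iterDirDeriv (l.map (stdOrthonormalBasis ℝ E')) a x‖ ≤ M) →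
      sobolevEnergy (k + 1) (fun x ↦ a x • g x) ≤ Ccr * ENNReal.ofReal (M ^ 2) * sobolevEnergy (k + 1) g)
    (hMv0 : ∀ i z, |cutAd Q A i z| ≤ Mv)
    (hMvw : ∀ i, ∀ l : List (Fin (Module.finrank ℝ E')), l ≠ [] → l.length ≤ k + 1 →
      ∀ z, ‖iterDirDeriv (l.map (stdOrthonormalBasis ℝ E')) (cutAd Q A i) z‖ ≤ Mv)
    (hpush : ∀ i, ENNReal.ofReal (max 1 (‖(A i : E' →L[ℝ] E')‖ ^ 2) ^ (k + 1) *
      |(LinearMap.det ((A i : E' →L[ℝ] E') : E' →ₗ[ℝ] E'))⁻¹|) ≤ Cpush)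
    {lam : ℝ} (hlam : 0 < lam) {s : ℝ} (hs : s ∈ Icc 0 T) :
    sobolevEnergy (k + 1) (vOne Q A T Θ s) ≤
      ENNReal.ofReal (Real.exp (2 * lam * s)) *
        (ENNReal.ofReal ((2 * (3 * Q.r) / Q.mesh + 1) ^ Module.finrank ℝ E') * (Cpush * (Ccr * ENNReal.ofReal (Mv ^ 2))) *
          ((Module.finrank ℝ E' : ℝ≥0∞) + ENNReal.ofReal lam⁻¹)) *
        ∑ i, ∫⁻ σ in Ioo 0 s, (fun (lam s : ℝ) ↦ ENNReal.ofReal (Real.exp (-2 * lam * s))) lam σ * sobolevEnergy k (dataAd Q A Θ i σ) := by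
  set C : ℝ≥0∞ := ENNReal.ofReal ((2 * (3 * Q.r) / Q.mesh + 1) ^ Module.finrank ℝ E') *
    (Cpush * (Ccr * ENNReal.ofReal (Mv ^ 2))) with hC
  set e : ℝ≥0∞ := (fun (lam s : ℝ) ↦ ENNReal.ofReal (Real.exp (-2 * lam * s))) lam s with he
  have hpt : sobolevEnergy (k + 1) (vOne Q A T Θ s) ≤ C * ∑ i, sobolevEnergy (k + 1) (wAd Q A T Θ i s) :=
    sobolevEnergy_vOne_le hT hΘ (k + 1) hcr hMv0 hMvw hpush hs
  have hi : ∀ i, e * sobolevEnergy (k + 1) (wAd Q A T Θ i s) ≤ ((Module.finrank ℝ E' : ℝ≥0∞) + ENNReal.ofReal lam⁻¹) *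
      ∫⁻ σ in Ioo 0 s, (fun (lam s : ℝ) ↦ ENNReal.ofReal (Real.exp (-2 * lam * s))) lam σ * sobolevEnergy k (dataAd Q A Θ i σ) := fun i ↦
    weight_mul_sobolevEnergy_succ_wAd_le hT hΘ k i hlam hs
  have hee : ENNReal.ofReal (Real.exp (2 * lam * s)) * e = 1 := by
    rw [he]
    simp only
    rw [← ENNReal.ofReal_mul (Real.exp_pos _).le, ← Real.exp_add]
    norm_num
  calc sobolevEnergy (k + 1) (vOne Q A T Θ s)
      = ENNReal.ofReal (Real.exp (2 * lam * s)) * (e * sobolevEnergy (k + 1) (vOne Q A T Θ s)) := by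
        rw [← mul_assoc, hee, one_mul]
    _ ≤ ENNReal.ofReal (Real.exp (2 * lam * s)) * (e * (C * ∑ i, sobolevEnergy (k + 1) (wAd Q A T Θ i s))) :=
        mul_le_mul' le_rfl (mul_le_mul' le_rfl hpt)
    _ = ENNReal.ofReal (Real.exp (2 * lam * s)) * (C * ∑ i, e * sobolevEnergy (k + 1) (wAd Q A T Θ i s)) := by
        rw [mul_left_comm e C, Finset.mul_sum]
    _ ≤ ENNReal.ofReal (Real.exp (2 * lam * s)) * (C * ∑ i, ((Module.finrank ℝ E' : ℝ≥0∞) + ENNReal.ofReal lam⁻¹) *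
          ∫⁻ σ in Ioo 0 s, (fun (lam s : ℝ) ↦ ENNReal.ofReal (Real.exp (-2 * lam * s))) lam σ * sobolevEnergy k (dataAd Q A Θ i σ)) :=
        mul_le_mul' le_rfl (mul_le_mul' le_rfl (Finset.sum_le_sum fun i _ ↦ hi i))
    _ = _ := by rw [← Finset.mul_sum]; ring

/-- **Pointwise-in-time energy of one step's residual, with the overlap multiplicity**: the factor
`#ι` of `sobolevEnergy_errOne_le` improves to `m₃ = (6r/mesh + 1)ⁿ`:
`E_k(errOne(s)) ≤ m₃ Cpush e^{2λs} (A₀ n² + B₀ (n + λ⁻¹)) 𝒩_{k+1}(Θ)(s)`. [cite: Hormander1985III, §17.1] -/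
theorem sobolevEnergy_errOne_le_overlap (hT : 0 < T) (hΘ : IsSmoothSpaceTimeOn (Icc 0 T) Θ)
    (hS : IsSmoothSpaceTimeOn (Icc 0 T) S) (h𝔟 : IsSmoothSpaceTimeOn (Icc 0 T) 𝔟) (h𝔠 : IsSmoothSpaceTimeOn (Icc 0 T) 𝔠)
    (k : ℕ) {A₀ B₀ Cpush : ℝ≥0∞}
    (hslice : ∀ i, ∀ s ∈ Icc 0 T, sobolevEnergy k (errAd Q A T S 𝔟 𝔠 Θ i s) ≤
      A₀ * ∑ a, ∑ l, sobolevEnergy k (fun y ↦ fderiv ℝ (fun z ↦ fderiv ℝ (wAd Q A T Θ i s) z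
        (stdOrthonormalBasis ℝ E' l)) y (stdOrthonormalBasis ℝ E' a)) +
      B₀ * (∑ l, sobolevEnergy k (fun z ↦ fderiv ℝ (wAd Q A T Θ i s) z (stdOrthonormalBasis ℝ E' l)) +
        sobolevEnergy k (wAd Q A T Θ i s)))
    (hpush : ∀ i, ENNReal.ofReal (max 1 (‖(A i : E' →L[ℝ] E')‖ ^ 2) ^ k *
      |(LinearMap.det ((A i : E' →L[ℝ] E') : E' →ₗ[ℝ] E'))⁻¹|) ≤ Cpush)
    {lam : ℝ} (hlam : 0 < lam) {s : ℝ} (hs : s ∈ Icc 0 T) :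
    sobolevEnergy k (errOne Q A T S 𝔟 𝔠 Θ s) ≤
      ENNReal.ofReal ((2 * (3 * Q.r) / Q.mesh + 1) ^ Module.finrank ℝ E') * Cpush *
        (ENNReal.ofReal (Real.exp (2 * lam * s)) *
          (A₀ * ((Module.finrank ℝ E' : ℝ≥0∞) * (Module.finrank ℝ E' : ℝ≥0∞)) +
            B₀ * ((Module.finrank ℝ E' : ℝ≥0∞) + ENNReal.ofReal lam⁻¹))) *
        ∑ i, ∫⁻ σ in Ioo 0 s, (fun (lam s : ℝ) ↦ ENNReal.ofReal (Real.exp (-2 * lam * s))) lam σ * sobolevEnergy (k + 1) (dataAd Q A Θ i σ) := by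
  have herrsl : ∀ i, ContDiff ℝ ∞ (errAd Q A T S 𝔟 𝔠 Θ i s) := fun i ↦
    (isSmoothSpaceTimeOn_errAd Q A T S 𝔟 𝔠 Θ hT hΘ hS h𝔟 h𝔠 i).contDiff_slice hs
  have hep : ∀ i, ContDiff ℝ ∞ (errPiece Q A T S 𝔟 𝔠 Θ i s) := fun i ↦ (herrsl i).comp (contDiff_psiInv i)
  have herr : errOne Q A T S 𝔟 𝔠 Θ s = fun y ↦ ∑ i ∈ Finset.univ, errPiece Q A T S 𝔟 𝔠 Θ i s y := rfl
  have h1 : sobolevEnergy k (errOne Q A T S 𝔟 𝔠 Θ s) ≤ ENNReal.ofReal ((2 * (3 * Q.r) / Q.mesh + 1) ^ Module.finrank ℝ E') *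
      ∑ i, sobolevEnergy k (errPiece Q A T S 𝔟 𝔠 Θ i s) := by
    rw [herr]
    exact sobolevEnergy_sum_le_of_overlap k Finset.univ (fun i ↦ closedBall (Q.c i) (3 * Q.r))
      (fun i _ ↦ (hep i).of_le (by exact_mod_cast le_top))
      (fun i _ ↦ tsupport_errPiece_subset Q A T S 𝔟 𝔠 Θ i s) (fun y t _ ht ↦ card_closedBall_three_le Q y t ht)
  have hterm : ∀ i, sobolevEnergy k (errPiece Q A T S 𝔟 𝔠 Θ i s) ≤
      Cpush * (ENNReal.ofReal (Real.exp (2 * lam * s)) * (A₀ * ((Module.finrank ℝ E' : ℝ≥0∞) *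
          (Module.finrank ℝ E' : ℝ≥0∞)) + B₀ * ((Module.finrank ℝ E' : ℝ≥0∞) + ENNReal.ofReal lam⁻¹)) *
        ∫⁻ σ in Ioo 0 s, (fun (lam s : ℝ) ↦ ENNReal.ofReal (Real.exp (-2 * lam * s))) lam σ * sobolevEnergy (k + 1) (dataAd Q A Θ i σ)) := by
    intro i
    rw [errPiece_eq_affine]
    calc sobolevEnergy k (fun y ↦ errAd Q A T S 𝔟 𝔠 Θ i s ((A i : E' →L[ℝ] E') y + A i (-Q.c i)))
        ≤ Cpush * sobolevEnergy k (errAd Q A T S 𝔟 𝔠 Θ i s) :=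
          (sobolevEnergy_comp_affine_le _ (det_frame_ne_zero A i) _ k (herrsl i)).trans (mul_le_mul' (hpush i) le_rfl)
      _ ≤ _ := mul_le_mul' le_rfl ((hslice i s hs).trans (slice_bound_flatLocalSol_le hT (isSmoothSpaceTimeOn_dataAd hΘ i)
              (isCompact_supportAd i) (dataAd_eq_zero i) k A₀ B₀ hlam hs))
  calc sobolevEnergy k (errOne Q A T S 𝔟 𝔠 Θ s)
      ≤ ENNReal.ofReal ((2 * (3 * Q.r) / Q.mesh + 1) ^ Module.finrank ℝ E') * ∑ i, sobolevEnergy k (errPiece Q A T S 𝔟 𝔠 Θ i s) := h1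
    _ ≤ ENNReal.ofReal ((2 * (3 * Q.r) / Q.mesh + 1) ^ Module.finrank ℝ E') * ∑ i,
          Cpush * (ENNReal.ofReal (Real.exp (2 * lam * s)) * (A₀ * ((Module.finrank ℝ E' : ℝ≥0∞) *
            (Module.finrank ℝ E' : ℝ≥0∞)) + B₀ * ((Module.finrank ℝ E' : ℝ≥0∞) + ENNReal.ofReal lam⁻¹)) *
          ∫⁻ σ in Ioo 0 s, (fun (lam s : ℝ) ↦ ENNReal.ofReal (Real.exp (-2 * lam * s))) lam σ * sobolevEnergy (k + 1) (dataAd Q A Θ i σ)) :=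
        mul_le_mul' le_rfl (Finset.sum_le_sum fun i _ ↦ hterm i)
    _ = _ := by rw [← Finset.mul_sum, ← Finset.mul_sum]; ring

/-! ### Energies of the Neumann approximate solution, uniformly in the number of steps -/

omit [FiniteDimensional ℝ E'] [MeasurableSpace E'] [BorelSpace E'] [FiniteDimensional ℝ F'] [Fintype ι] in
/-- Geometric weights against the contraction: `2ᵐ · (1/4)ᵐ = (1/2)ᵐ` and `Σ_{m<N} (1/2)ᵐ ≤ 2`, in
`ℝ≥0∞`. [folklore] -/
theorem sum_ofReal_two_pow_mul_quarter_pow_le (N : ℕ) (X : ℝ≥0∞) :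
    ∑ m ∈ Finset.range N, ENNReal.ofReal (((2 : ℝ)⁻¹ ^ m)⁻¹) * ((ENNReal.ofReal 4⁻¹) ^ m * X) ≤ 2 * X := by
  have hm : ∀ m : ℕ, ENNReal.ofReal (((2 : ℝ)⁻¹ ^ m)⁻¹) * (ENNReal.ofReal 4⁻¹) ^ m = ENNReal.ofReal ((1 / 2 : ℝ) ^ m) := by
    intro m
    rw [← ENNReal.ofReal_pow (by norm_num), ← ENNReal.ofReal_mul (by positivity), inv_pow, inv_inv, ← mul_pow]
    norm_num
  calc ∑ m ∈ Finset.range N, ENNReal.ofReal (((2 : ℝ)⁻¹ ^ m)⁻¹) * ((ENNReal.ofReal 4⁻¹) ^ m * X)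
      = (∑ m ∈ Finset.range N, ENNReal.ofReal ((1 / 2 : ℝ) ^ m)) * X := by
        rw [Finset.sum_mul]
        exact Finset.sum_congr rfl fun m _ ↦ by rw [← mul_assoc, hm]
    _ ≤ 2 * X := by
        refine mul_le_mul' ?_ le_rfl
        rw [← ENNReal.ofReal_sum_of_nonneg fun m _ ↦ by positivity, ← ENNReal.ofReal_ofNat]
        exact ENNReal.ofReal_le_ofReal (sum_geometric_two_le N)

/-- **Weighted energies of the Neumann approximate solution with `λ`-gain, uniformly in `N`**: if
one step contracts `𝒩_k` by `1/4` (at the weight `λ` and time `t`), then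
`∫₀ᵗ e^{-2λs} (Σ_a E_k(∂_a v_N) + E_k(v_N)) ≤ 8 m₃ Cpush Ccr Mv² (λ⁻¹/2 + λ⁻²) 𝒩_k(Θ)(t)` for every `N`
(weighted Cauchy–Schwarz over the steps with weights `2^{-m}`). [cite: Hormander1985III, §17.1] -/
theorem lintegral_weight_energy_vNeumann_le (hT : 0 < T) (hΘ : IsSmoothSpaceTimeOn (Icc 0 T) Θ)
    (hS : IsSmoothSpaceTimeOn (Icc 0 T) S) (h𝔟 : IsSmoothSpaceTimeOn (Icc 0 T) 𝔟) (h𝔠 : IsSmoothSpaceTimeOn (Icc 0 T) 𝔠)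
    (k : ℕ) {Ccr Cpush : ℝ≥0∞} {Mv : ℝ}
    (hcr : ∀ {a : E' → ℝ} {g : E' → F'}, ContDiff ℝ ∞ a → ContDiff ℝ ∞ g → ∀ {M : ℝ}, (∀ x, |a x| ≤ M) →
      (∀ l : List (Fin (Module.finrank ℝ E')), l ≠ [] → l.length ≤ k + 1 →
        ∀ x, ‖iterDirDeriv (l.map (stdOrthonormalBasis ℝ E')) a x‖ ≤ M) →
      sobolevEnergy (k + 1) (fun x ↦ a x • g x) ≤ Ccr * ENNReal.ofReal (M ^ 2) * sobolevEnergy (k + 1) g)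
    (hMv0 : ∀ i z, |cutAd Q A i z| ≤ Mv)
    (hMvw : ∀ i, ∀ l : List (Fin (Module.finrank ℝ E')), l ≠ [] → l.length ≤ k + 1 →
      ∀ z, ‖iterDirDeriv (l.map (stdOrthonormalBasis ℝ E')) (cutAd Q A i) z‖ ≤ Mv)
    (hpush : ∀ i, ENNReal.ofReal (max 1 (‖(A i : E' →L[ℝ] E')‖ ^ 2) ^ (k + 1) *
      |(LinearMap.det ((A i : E' →L[ℝ] E') : E' →ₗ[ℝ] E'))⁻¹|) ≤ Cpush)
    {lam : ℝ} (hlam : 0 < lam) {t : ℝ} (ht : t ∈ Icc 0 T)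
    (hstep : ∀ Θ' : ℝ → E' → F', IsSmoothSpaceTimeOn (Icc 0 T) Θ' →
      ∑ j, ∫⁻ s in Ioo 0 t, (fun (lam s : ℝ) ↦ ENNReal.ofReal (Real.exp (-2 * lam * s))) lam s * sobolevEnergy k (dataAd Q A (errOne Q A T S 𝔟 𝔠 Θ') j s) ≤
        ENNReal.ofReal 4⁻¹ * ∑ i, ∫⁻ s in Ioo 0 t, (fun (lam s : ℝ) ↦ ENNReal.ofReal (Real.exp (-2 * lam * s))) lam s * sobolevEnergy k (dataAd Q A Θ' i s))
    (N : ℕ) :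
    ∫⁻ s in Ioo 0 t, (fun (lam s : ℝ) ↦ ENNReal.ofReal (Real.exp (-2 * lam * s))) lam s * ((∑ a, sobolevEnergy k (fun y ↦ fderiv ℝ (vNeumann Q A T S 𝔟 𝔠 Θ N s) y
        (stdOrthonormalBasis ℝ E' a))) + sobolevEnergy k (vNeumann Q A T S 𝔟 𝔠 Θ N s)) ≤
      8 * (ENNReal.ofReal ((2 * (3 * Q.r) / Q.mesh + 1) ^ Module.finrank ℝ E') * (Cpush * (Ccr * ENNReal.ofReal (Mv ^ 2)))) *
        (ENNReal.ofReal (lam⁻¹ / 2) + ENNReal.ofReal (lam⁻¹ ^ 2)) *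
        ∑ i, ∫⁻ s in Ioo 0 t, (fun (lam s : ℝ) ↦ ENNReal.ofReal (Real.exp (-2 * lam * s))) lam s * sobolevEnergy k (dataAd Q A Θ i s) := by
  set C : ℝ≥0∞ := ENNReal.ofReal ((2 * (3 * Q.r) / Q.mesh + 1) ^ Module.finrank ℝ E') *
    (Cpush * (Ccr * ENNReal.ofReal (Mv ^ 2))) with hC
  set Rl : ℝ≥0∞ := ENNReal.ofReal (lam⁻¹ / 2) + ENNReal.ofReal (lam⁻¹ ^ 2) with hRl
  set 𝒩 : ℝ≥0∞ := ∑ i, ∫⁻ s in Ioo 0 t, (fun (lam s : ℝ) ↦ ENNReal.ofReal (Real.exp (-2 * lam * s))) lam s * sobolevEnergy k (dataAd Q A Θ i s) with h𝒩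
  set Θm := dataIter Q A T S 𝔟 𝔠 Θ with hΘm
  set c : ℕ → ℝ := fun m ↦ (2 : ℝ)⁻¹ ^ m with hc
  have hcpos : ∀ m, 0 < c m := fun m ↦ by positivity
  have hsm : ∀ m, IsSmoothSpaceTimeOn (Icc 0 T) (Θm m) := isSmoothSpaceTimeOn_dataIter hT hΘ hS h𝔟 h𝔠
  have hWm : Measurable ((fun (lam s : ℝ) ↦ ENNReal.ofReal (Real.exp (-2 * lam * s))) lam) :=
    (Real.continuous_exp.comp (continuous_const.mul continuous_id)).measurable.ennreal_ofReal
  have hvs : ∀ m, IsSmoothSpaceTimeOn (Icc 0 T) (vOne Q A T (Θm m)) := fun m ↦ isSmoothSpaceTimeOn_vOne hT (hsm m)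
  -- pointwise in time: weighted Cauchy–Schwarz over the steps
  have hpt : ∀ s ∈ Icc 0 T, (∑ a, sobolevEnergy k (fun y ↦ fderiv ℝ (vNeumann Q A T S 𝔟 𝔠 Θ N s) y
      (stdOrthonormalBasis ℝ E' a))) + sobolevEnergy k (vNeumann Q A T S 𝔟 𝔠 Θ N s) ≤
      4 * ∑ m ∈ Finset.range N, ENNReal.ofReal (c m)⁻¹ * sobolevEnergy (k + 1) (vOne Q A T (Θm m) s) := by
    intro s hs
    have hv : vNeumann Q A T S 𝔟 𝔠 Θ N s = fun y ↦ ∑ m ∈ Finset.range N, vOne Q A T (Θm m) s y := rfl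
    refine (sum_sobolevEnergy_fderiv_add_le k _).trans ?_
    rw [hv]
    have h := sobolevEnergy_sum_le_weighted (k + 1) (Finset.range N) (f := fun m ↦ vOne Q A T (Θm m) s) (c := c)
      (fun m _ ↦ ((hvs m).contDiff_slice hs).of_le (by exact_mod_cast le_top)) (fun m _ ↦ hcpos m)
    have h2 : ENNReal.ofReal (∑ m ∈ Finset.range N, c m) ≤ 2 := by
      rw [← ENNReal.ofReal_ofNat]
      refine ENNReal.ofReal_le_ofReal ?_
      have := sum_geometric_two_le N
      simpa [hc, one_div] using this
    calc 2 * sobolevEnergy (k + 1) (fun y ↦ ∑ m ∈ Finset.range N, vOne Q A T (Θm m) s y)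
        ≤ 2 * (ENNReal.ofReal (∑ m ∈ Finset.range N, c m) *
            ∑ m ∈ Finset.range N, ENNReal.ofReal (c m)⁻¹ * sobolevEnergy (k + 1) (vOne Q A T (Θm m) s)) :=
          mul_le_mul' le_rfl h
      _ ≤ 2 * (2 * ∑ m ∈ Finset.range N, ENNReal.ofReal (c m)⁻¹ * sobolevEnergy (k + 1) (vOne Q A T (Θm m) s)) :=
          mul_le_mul' le_rfl (mul_le_mul' h2 le_rfl)
      _ = _ := by ring
  -- integrate
  have mE : ∀ m, AEMeasurable (fun s ↦ (fun (lam s : ℝ) ↦ ENNReal.ofReal (Real.exp (-2 * lam * s))) lam s * sobolevEnergy (k + 1) (vOne Q A T (Θm m) s)) (volume.restrict (Ioo 0 t)) :=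
    fun m ↦ hWm.aemeasurable.mul (aemeasurable_sobolevEnergy_slice_Ioo' (hvs m) (k + 1) ht.2)
  have mE' : ∀ m, AEMeasurable (fun s ↦ ENNReal.ofReal (c m)⁻¹ * ((fun (lam s : ℝ) ↦ ENNReal.ofReal (Real.exp (-2 * lam * s))) lam s * sobolevEnergy (k + 1) (vOne Q A T (Θm m) s)))
      (volume.restrict (Ioo 0 t)) := fun m ↦ (mE m).const_mul _
  have hint : ∫⁻ s in Ioo 0 t, (fun (lam s : ℝ) ↦ ENNReal.ofReal (Real.exp (-2 * lam * s))) lam s * ((∑ a, sobolevEnergy k (fun y ↦ fderiv ℝ (vNeumann Q A T S 𝔟 𝔠 Θ N s) y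
      (stdOrthonormalBasis ℝ E' a))) + sobolevEnergy k (vNeumann Q A T S 𝔟 𝔠 Θ N s)) ≤
      4 * ∑ m ∈ Finset.range N, ENNReal.ofReal (c m)⁻¹ * ∫⁻ s in Ioo 0 t, (fun (lam s : ℝ) ↦ ENNReal.ofReal (Real.exp (-2 * lam * s))) lam s * sobolevEnergy (k + 1) (vOne Q A T (Θm m) s) := by
    calc _ ≤ ∫⁻ s in Ioo 0 t, (fun (lam s : ℝ) ↦ ENNReal.ofReal (Real.exp (-2 * lam * s))) lam s * (4 * ∑ m ∈ Finset.range N, ENNReal.ofReal (c m)⁻¹ * sobolevEnergy (k + 1) (vOne Q A T (Θm m) s)) :=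
          setLIntegral_mono' measurableSet_Ioo fun s hs ↦ mul_le_mul' le_rfl (hpt s ⟨hs.1.le, hs.2.le.trans ht.2⟩)
      _ = ∫⁻ s in Ioo 0 t, 4 * ∑ m ∈ Finset.range N, ENNReal.ofReal (c m)⁻¹ * ((fun (lam s : ℝ) ↦ ENNReal.ofReal (Real.exp (-2 * lam * s))) lam s * sobolevEnergy (k + 1) (vOne Q A T (Θm m) s)) := by
          refine lintegral_congr fun s ↦ ?_
          rw [mul_left_comm, Finset.mul_sum, Finset.mul_sum, Finset.mul_sum]
          exact Finset.sum_congr rfl fun m _ ↦ by ring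
      _ = 4 * ∑ m ∈ Finset.range N, ENNReal.ofReal (c m)⁻¹ * ∫⁻ s in Ioo 0 t, (fun (lam s : ℝ) ↦ ENNReal.ofReal (Real.exp (-2 * lam * s))) lam s * sobolevEnergy (k + 1) (vOne Q A T (Θm m) s) := by
          rw [lintegral_const_mul'' _ (Finset.aemeasurable_fun_sum _ fun m _ ↦ mE' m), lintegral_finsetSum' _ fun m _ ↦ mE' m]
          congr 1
          exact Finset.sum_congr rfl fun m _ ↦ lintegral_const_mul'' _ (mE m)
  -- each step: one-step bound and the contraction
  have hNm : ∀ m, ∑ i, ∫⁻ s in Ioo 0 t, (fun (lam s : ℝ) ↦ ENNReal.ofReal (Real.exp (-2 * lam * s))) lam s * sobolevEnergy k (dataAd Q A (Θm m) i s) ≤ (ENNReal.ofReal 4⁻¹) ^ m * 𝒩 :=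
    norm_dataIter_le hT hΘ hS h𝔟 h𝔠 k hstep
  have hm : ∀ m, ∫⁻ s in Ioo 0 t, (fun (lam s : ℝ) ↦ ENNReal.ofReal (Real.exp (-2 * lam * s))) lam s * sobolevEnergy (k + 1) (vOne Q A T (Θm m) s) ≤ C * Rl * ((ENNReal.ofReal 4⁻¹) ^ m * 𝒩) :=
    fun m ↦ (lintegral_weight_sobolevEnergy_succ_vOne_le hT (hsm m) k hcr hMv0 hMvw hpush hlam ht).trans
      (mul_le_mul' le_rfl (hNm m))
  calc _ ≤ 4 * ∑ m ∈ Finset.range N, ENNReal.ofReal (c m)⁻¹ * ∫⁻ s in Ioo 0 t, (fun (lam s : ℝ) ↦ ENNReal.ofReal (Real.exp (-2 * lam * s))) lam s * sobolevEnergy (k + 1) (vOne Q A T (Θm m) s) := hint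
    _ ≤ 4 * ∑ m ∈ Finset.range N, ENNReal.ofReal (c m)⁻¹ * (C * Rl * ((ENNReal.ofReal 4⁻¹) ^ m * 𝒩)) :=
        mul_le_mul' le_rfl (Finset.sum_le_sum fun m _ ↦ mul_le_mul' le_rfl (hm m))
    _ = 4 * (C * Rl) * ∑ m ∈ Finset.range N, ENNReal.ofReal (c m)⁻¹ * ((ENNReal.ofReal 4⁻¹) ^ m * 𝒩) := by
        rw [mul_assoc 4 (C * Rl), Finset.mul_sum (a := C * Rl)]
        congr 1
        exact Finset.sum_congr rfl fun m _ ↦ by ring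
    _ ≤ 4 * (C * Rl) * (2 * 𝒩) := mul_le_mul' le_rfl (sum_ofReal_two_pow_mul_quarter_pow_le N 𝒩)
    _ = 8 * C * Rl * 𝒩 := by ring

/-- **Pointwise-in-time energies of the Neumann approximate solution, uniformly in `N`**: if one
step contracts `𝒩_k` by `1/4` (at the weight `λ` and time `s`), then
`Σ_a E_k(∂_a v_N(s)) + E_k(v_N(s)) ≤ e^{2λs} 8 m₃ Cpush Ccr Mv² (n + λ⁻¹) 𝒩_k(Θ)(s)`.
[cite: Hormander1985III, §17.1] -/
theorem energy_vNeumann_le_exp (hT : 0 < T) (hΘ : IsSmoothSpaceTimeOn (Icc 0 T) Θ)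
    (hS : IsSmoothSpaceTimeOn (Icc 0 T) S) (h𝔟 : IsSmoothSpaceTimeOn (Icc 0 T) 𝔟) (h𝔠 : IsSmoothSpaceTimeOn (Icc 0 T) 𝔠)
    (k : ℕ) {Ccr Cpush : ℝ≥0∞} {Mv : ℝ}
    (hcr : ∀ {a : E' → ℝ} {g : E' → F'}, ContDiff ℝ ∞ a → ContDiff ℝ ∞ g → ∀ {M : ℝ}, (∀ x, |a x| ≤ M) →
      (∀ l : List (Fin (Module.finrank ℝ E')), l ≠ [] → l.length ≤ k + 1 →
        ∀ x, ‖iterDirDeriv (l.map (stdOrthonormalBasis ℝ E')) a x‖ ≤ M) →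
      sobolevEnergy (k + 1) (fun x ↦ a x • g x) ≤ Ccr * ENNReal.ofReal (M ^ 2) * sobolevEnergy (k + 1) g)
    (hMv0 : ∀ i z, |cutAd Q A i z| ≤ Mv)
    (hMvw : ∀ i, ∀ l : List (Fin (Module.finrank ℝ E')), l ≠ [] → l.length ≤ k + 1 →
      ∀ z, ‖iterDirDeriv (l.map (stdOrthonormalBasis ℝ E')) (cutAd Q A i) z‖ ≤ Mv)
    (hpush : ∀ i, ENNReal.ofReal (max 1 (‖(A i : E' →L[ℝ] E')‖ ^ 2) ^ (k + 1) *
      |(LinearMap.det ((A i : E' →L[ℝ] E') : E' →ₗ[ℝ] E'))⁻¹|) ≤ Cpush)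
    {lam : ℝ} (hlam : 0 < lam) {s : ℝ} (hs : s ∈ Icc 0 T)
    (hstep : ∀ Θ' : ℝ → E' → F', IsSmoothSpaceTimeOn (Icc 0 T) Θ' →
      ∑ j, ∫⁻ σ in Ioo 0 s, (fun (lam s : ℝ) ↦ ENNReal.ofReal (Real.exp (-2 * lam * s))) lam σ * sobolevEnergy k (dataAd Q A (errOne Q A T S 𝔟 𝔠 Θ') j σ) ≤
        ENNReal.ofReal 4⁻¹ * ∑ i, ∫⁻ σ in Ioo 0 s, (fun (lam s : ℝ) ↦ ENNReal.ofReal (Real.exp (-2 * lam * s))) lam σ * sobolevEnergy k (dataAd Q A Θ' i σ))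
    (N : ℕ) :
    (∑ a, sobolevEnergy k (fun y ↦ fderiv ℝ (vNeumann Q A T S 𝔟 𝔠 Θ N s) y (stdOrthonormalBasis ℝ E' a))) +
        sobolevEnergy k (vNeumann Q A T S 𝔟 𝔠 Θ N s) ≤
      ENNReal.ofReal (Real.exp (2 * lam * s)) *
        (8 * (ENNReal.ofReal ((2 * (3 * Q.r) / Q.mesh + 1) ^ Module.finrank ℝ E') * (Cpush * (Ccr * ENNReal.ofReal (Mv ^ 2)))) *
          ((Module.finrank ℝ E' : ℝ≥0∞) + ENNReal.ofReal lam⁻¹)) *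
        ∑ i, ∫⁻ σ in Ioo 0 s, (fun (lam s : ℝ) ↦ ENNReal.ofReal (Real.exp (-2 * lam * s))) lam σ * sobolevEnergy k (dataAd Q A Θ i σ) := by
  set C : ℝ≥0∞ := ENNReal.ofReal ((2 * (3 * Q.r) / Q.mesh + 1) ^ Module.finrank ℝ E') *
    (Cpush * (Ccr * ENNReal.ofReal (Mv ^ 2))) with hC
  set G : ℝ≥0∞ := (Module.finrank ℝ E' : ℝ≥0∞) + ENNReal.ofReal lam⁻¹ with hG
  set X : ℝ≥0∞ := ENNReal.ofReal (Real.exp (2 * lam * s)) with hX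
  set 𝒩 : ℝ≥0∞ := ∑ i, ∫⁻ σ in Ioo 0 s, (fun (lam s : ℝ) ↦ ENNReal.ofReal (Real.exp (-2 * lam * s))) lam σ * sobolevEnergy k (dataAd Q A Θ i σ) with h𝒩
  set Θm := dataIter Q A T S 𝔟 𝔠 Θ with hΘm
  set c : ℕ → ℝ := fun m ↦ (2 : ℝ)⁻¹ ^ m with hc
  have hcpos : ∀ m, 0 < c m := fun m ↦ by positivity
  have hsm : ∀ m, IsSmoothSpaceTimeOn (Icc 0 T) (Θm m) := isSmoothSpaceTimeOn_dataIter hT hΘ hS h𝔟 h𝔠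
  have hvs : ∀ m, IsSmoothSpaceTimeOn (Icc 0 T) (vOne Q A T (Θm m)) := fun m ↦ isSmoothSpaceTimeOn_vOne hT (hsm m)
  have hv : vNeumann Q A T S 𝔟 𝔠 Θ N s = fun y ↦ ∑ m ∈ Finset.range N, vOne Q A T (Θm m) s y := rfl
  have h := sobolevEnergy_sum_le_weighted (k + 1) (Finset.range N) (f := fun m ↦ vOne Q A T (Θm m) s) (c := c)
    (fun m _ ↦ ((hvs m).contDiff_slice hs).of_le (by exact_mod_cast le_top)) (fun m _ ↦ hcpos m)
  have h2 : ENNReal.ofReal (∑ m ∈ Finset.range N, c m) ≤ 2 := by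
    rw [← ENNReal.ofReal_ofNat]
    refine ENNReal.ofReal_le_ofReal ?_
    have := sum_geometric_two_le N
    simpa [hc, one_div] using this
  have hNm : ∀ m, ∑ i, ∫⁻ σ in Ioo 0 s, (fun (lam s : ℝ) ↦ ENNReal.ofReal (Real.exp (-2 * lam * s))) lam σ * sobolevEnergy k (dataAd Q A (Θm m) i σ) ≤ (ENNReal.ofReal 4⁻¹) ^ m * 𝒩 :=
    norm_dataIter_le hT hΘ hS h𝔟 h𝔠 k hstep
  have hm : ∀ m, sobolevEnergy (k + 1) (vOne Q A T (Θm m) s) ≤ X * (C * G) * ((ENNReal.ofReal 4⁻¹) ^ m * 𝒩) :=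
    fun m ↦ (sobolevEnergy_succ_vOne_le_exp hT (hsm m) k hcr hMv0 hMvw hpush hlam hs).trans (mul_le_mul' le_rfl (hNm m))
  calc (∑ a, sobolevEnergy k (fun y ↦ fderiv ℝ (vNeumann Q A T S 𝔟 𝔠 Θ N s) y (stdOrthonormalBasis ℝ E' a))) +
        sobolevEnergy k (vNeumann Q A T S 𝔟 𝔠 Θ N s)
      ≤ 2 * sobolevEnergy (k + 1) (vNeumann Q A T S 𝔟 𝔠 Θ N s) := sum_sobolevEnergy_fderiv_add_le k _
    _ ≤ 2 * (ENNReal.ofReal (∑ m ∈ Finset.range N, c m) *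
          ∑ m ∈ Finset.range N, ENNReal.ofReal (c m)⁻¹ * sobolevEnergy (k + 1) (vOne Q A T (Θm m) s)) := by
        rw [hv]; exact mul_le_mul' le_rfl h
    _ ≤ 2 * (2 * ∑ m ∈ Finset.range N, ENNReal.ofReal (c m)⁻¹ * (X * (C * G) * ((ENNReal.ofReal 4⁻¹) ^ m * 𝒩))) :=
        mul_le_mul' le_rfl (mul_le_mul' h2 (Finset.sum_le_sum fun m _ ↦ mul_le_mul' le_rfl (hm m)))
    _ = 4 * (X * (C * G)) * ∑ m ∈ Finset.range N, ENNReal.ofReal (c m)⁻¹ * ((ENNReal.ofReal 4⁻¹) ^ m * 𝒩) := by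
        rw [← mul_assoc 2 2, Finset.mul_sum, Finset.mul_sum]
        exact Finset.sum_congr rfl fun m _ ↦ by ring
    _ ≤ 4 * (X * (C * G)) * (2 * 𝒩) := mul_le_mul' le_rfl (sum_ofReal_two_pow_mul_quarter_pow_le N 𝒩)
    _ = X * (8 * C * G) * 𝒩 := by ring

/-! ### The initial data norm in integral form -/

omit [FiniteDimensional ℝ F'] in
/-- **The per-patch data norm in terms of the data**, integral form:
`Σ_i ∫_{(0,t)} e^{-2λs} E_k(Θ̃_i(s)) ds ≤ (2(ϱ + 2r)/mesh + 1)ⁿ C_d ∫_{(0,t)} e^{-2λs} E_k(Θ(s)) ds` when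
`E_k(Θ̃_i(s)) ≤ C_d E_k(Θ(s))` and `Θ(s)` is supported in `closedBall 0 ϱ` (only the patches with
`‖c_i‖ ≤ ϱ + 2r` carry data). [cite: Hormander1985III, §17.1] -/
theorem sum_lintegral_dataAd_le_count (hΘ : IsSmoothSpaceTimeOn (Icc 0 T) Θ) {ϱ : ℝ} (hϱ : 0 ≤ ϱ)
    (hΘϱ : ∀ s y, Θ s y ≠ 0 → y ∈ closedBall (0 : E') ϱ) (k : ℕ) {Cd : ℝ≥0∞}
    (hCd : ∀ i, ∀ s ∈ Icc 0 T, sobolevEnergy k (dataAd Q A Θ i s) ≤ Cd * sobolevEnergy k (Θ s))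
    (lam : ℝ) {t : ℝ} (ht : t ∈ Icc 0 T) :
    ∑ i, (∫⁻ s in Ioo 0 t, (fun (lam s : ℝ) ↦ ENNReal.ofReal (Real.exp (-2 * lam * s))) lam s * sobolevEnergy k (dataAd Q A Θ i s)) ≤
      ENNReal.ofReal ((2 * (ϱ + 2 * Q.r) / Q.mesh + 1) ^ Module.finrank ℝ E') * Cd *
        ∫⁻ s in Ioo 0 t, (fun (lam s : ℝ) ↦ ENNReal.ofReal (Real.exp (-2 * lam * s))) lam s * sobolevEnergy k (Θ s) := by
  classical
  have hWm : Measurable ((fun (lam s : ℝ) ↦ ENNReal.ofReal (Real.exp (-2 * lam * s))) lam) :=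
    (Real.continuous_exp.comp (continuous_const.mul continuous_id)).measurable.ennreal_ofReal
  have mE : AEMeasurable (fun s ↦ (fun (lam s : ℝ) ↦ ENNReal.ofReal (Real.exp (-2 * lam * s))) lam s * sobolevEnergy k (Θ s)) (volume.restrict (Ioo 0 t)) :=
    hWm.aemeasurable.mul (aemeasurable_sobolevEnergy_slice_Ioo' hΘ k ht.2)
  set act : Finset ι := Finset.univ.filter fun i ↦ ‖Q.c i‖ ≤ ϱ + 2 * Q.r with hact
  have hzero : ∀ i ∉ act, ∀ s, sobolevEnergy k (dataAd Q A Θ i s) = 0 := by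
    intro i hi s
    have hfar : ϱ + 2 * Q.r < ‖Q.c i‖ := by
      by_contra h; exact hi (Finset.mem_filter.2 ⟨Finset.mem_univ _, not_lt.1 h⟩)
    rw [dataAd_eq_zero_of_far hΘϱ i hfar s]
    exact sobolevEnergy_zero_fun k
  have hsplit : ∑ i, (∫⁻ s in Ioo 0 t, (fun (lam s : ℝ) ↦ ENNReal.ofReal (Real.exp (-2 * lam * s))) lam s * sobolevEnergy k (dataAd Q A Θ i s)) =
      ∑ i ∈ act, (∫⁻ s in Ioo 0 t, (fun (lam s : ℝ) ↦ ENNReal.ofReal (Real.exp (-2 * lam * s))) lam s * sobolevEnergy k (dataAd Q A Θ i s)) := by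
    refine (Finset.sum_subset (Finset.subset_univ act) fun i _ hi ↦ ?_).symm
    simp [hzero i hi]
  rw [hsplit]
  have hterm : ∀ i, (∫⁻ s in Ioo 0 t, (fun (lam s : ℝ) ↦ ENNReal.ofReal (Real.exp (-2 * lam * s))) lam s * sobolevEnergy k (dataAd Q A Θ i s)) ≤
      Cd * ∫⁻ s in Ioo 0 t, (fun (lam s : ℝ) ↦ ENNReal.ofReal (Real.exp (-2 * lam * s))) lam s * sobolevEnergy k (Θ s) := by
    intro i
    calc (∫⁻ s in Ioo 0 t, (fun (lam s : ℝ) ↦ ENNReal.ofReal (Real.exp (-2 * lam * s))) lam s * sobolevEnergy k (dataAd Q A Θ i s))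
        ≤ ∫⁻ s in Ioo 0 t, Cd * ((fun (lam s : ℝ) ↦ ENNReal.ofReal (Real.exp (-2 * lam * s))) lam s * sobolevEnergy k (Θ s)) := by
          refine setLIntegral_mono' measurableSet_Ioo fun s hs ↦ ?_
          rw [mul_left_comm]
          exact mul_le_mul' le_rfl (hCd i s ⟨hs.1.le, hs.2.le.trans ht.2⟩)
      _ = Cd * ∫⁻ s in Ioo 0 t, (fun (lam s : ℝ) ↦ ENNReal.ofReal (Real.exp (-2 * lam * s))) lam s * sobolevEnergy k (Θ s) := lintegral_const_mul'' _ mE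
  have hcard : (act.card : ℝ) ≤ (2 * (ϱ + 2 * Q.r) / Q.mesh + 1) ^ Module.finrank ℝ E' := by
    refine Q.card_le 0 (ϱ + 2 * Q.r) (by linarith [Q.r_pos]) act fun i hi ↦ ?_
    rw [dist_comm, dist_zero_right]
    exact (Finset.mem_filter.1 hi).2
  calc ∑ i ∈ act, (∫⁻ s in Ioo 0 t, (fun (lam s : ℝ) ↦ ENNReal.ofReal (Real.exp (-2 * lam * s))) lam s * sobolevEnergy k (dataAd Q A Θ i s))
      ≤ ∑ _i ∈ act, Cd * ∫⁻ s in Ioo 0 t, (fun (lam s : ℝ) ↦ ENNReal.ofReal (Real.exp (-2 * lam * s))) lam s * sobolevEnergy k (Θ s) := Finset.sum_le_sum fun i _ ↦ hterm i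
    _ = (act.card : ℝ≥0∞) * (Cd * ∫⁻ s in Ioo 0 t, (fun (lam s : ℝ) ↦ ENNReal.ofReal (Real.exp (-2 * lam * s))) lam s * sobolevEnergy k (Θ s)) := by
        rw [Finset.sum_const, nsmul_eq_mul]
    _ ≤ ENNReal.ofReal ((2 * (ϱ + 2 * Q.r) / Q.mesh + 1) ^ Module.finrank ℝ E') *
          (Cd * ∫⁻ s in Ioo 0 t, (fun (lam s : ℝ) ↦ ENNReal.ofReal (Real.exp (-2 * lam * s))) lam s * sobolevEnergy k (Θ s)) := by
        refine mul_le_mul' ?_ le_rfl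
        rw [← ENNReal.ofReal_natCast]
        exact ENNReal.ofReal_le_ofReal hcard
    _ = _ := by ring

/-! ### The contraction factor -/

omit [FiniteDimensional ℝ E'] [MeasurableSpace E'] [BorelSpace E'] [FiniteDimensional ℝ F'] [Fintype ι] in
/-- `λ⁻¹/2 + λ⁻² ≤ 2 λ⁻¹` for `λ ≥ 1`, in `ℝ≥0∞`. [folklore] -/
theorem ofReal_inv_half_add_sq_le {lam : ℝ} (hlam : 1 ≤ lam) :
    ENNReal.ofReal (lam⁻¹ / 2) + ENNReal.ofReal (lam⁻¹ ^ 2) ≤ 2 * ENNReal.ofReal lam⁻¹ := by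
  have hl0 : 0 < lam := one_pos.trans_le hlam
  rw [← ENNReal.ofReal_add (by positivity) (by positivity), ← ENNReal.ofReal_ofNat, ← ENNReal.ofReal_mul (by norm_num)]
  refine ENNReal.ofReal_le_ofReal ?_
  have h1 : lam⁻¹ ≤ 1 := inv_le_one_of_one_le₀ hlam
  have h0 : 0 ≤ lam⁻¹ := inv_nonneg.2 hl0.le
  nlinarith

omit [FiniteDimensional ℝ E'] [MeasurableSpace E'] [BorelSpace E'] [FiniteDimensional ℝ F'] [Fintype ι] in
/-- Products of `ofReal`s (bookkeeping for the smallness condition). [folklore] -/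
theorem ofReal_sq_mul_mul_eq {x c a : ℝ} (hx : 0 ≤ x) (hc : 0 ≤ c) (ha : 0 ≤ a) (n : ℕ) :
    ENNReal.ofReal x ^ 2 * ENNReal.ofReal c * (2 * ENNReal.ofReal a * (n : ℝ≥0∞)) =
      ENNReal.ofReal (x ^ 2 * c * (2 * a * n)) := by
  rw [← ENNReal.ofReal_pow hx, ← ENNReal.ofReal_natCast n, ← ENNReal.ofReal_ofNat 2,
    ← ENNReal.ofReal_mul (show (0 : ℝ) ≤ 2 by norm_num), ← ENNReal.ofReal_mul (show (0 : ℝ) ≤ 2 * a by positivity),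
    ← ENNReal.ofReal_mul (show (0 : ℝ) ≤ x ^ 2 by positivity), ← ENNReal.ofReal_mul (show (0 : ℝ) ≤ x ^ 2 * c by positivity)]

omit [FiniteDimensional ℝ E'] [MeasurableSpace E'] [BorelSpace E'] [FiniteDimensional ℝ F'] [Fintype ι] in
/-- Splitting the one-step factor of `FlatStepEnergy` into a `λ`-independent part and a part with
the gain `λ⁻¹` (`λ ≥ 1`). [folklore] -/
theorem step_factor_le (mm Ctr A₀ B₀ Csh M nn : ℝ≥0∞) {lam : ℝ} (hlam : 1 ≤ lam) :
    mm ^ 2 * Ctr * (2 * (A₀ * nn + B₀ * (ENNReal.ofReal (lam⁻¹ / 2) + ENNReal.ofReal (lam⁻¹ ^ 2))) +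
        Csh * M * (A₀ * nn * ENNReal.ofReal (lam⁻¹ / 2) + B₀ * (ENNReal.ofReal (lam⁻¹ / 2) + ENNReal.ofReal (lam⁻¹ ^ 2)))) ≤
      mm ^ 2 * Ctr * (2 * A₀ * nn) +
        mm ^ 2 * Ctr * (4 * B₀ + Csh * M * (A₀ * nn + 2 * B₀)) * ENNReal.ofReal lam⁻¹ := by
  set u : ℝ≥0∞ := ENNReal.ofReal lam⁻¹ with hu
  have hl0 : 0 < lam := one_pos.trans_le hlam
  have hR : ENNReal.ofReal (lam⁻¹ / 2) + ENNReal.ofReal (lam⁻¹ ^ 2) ≤ 2 * u := ofReal_inv_half_add_sq_le hlam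
  have hh : ENNReal.ofReal (lam⁻¹ / 2) ≤ u := ENNReal.ofReal_le_ofReal (by linarith [inv_nonneg.2 hl0.le])
  calc _ ≤ mm ^ 2 * Ctr * (2 * (A₀ * nn + B₀ * (2 * u)) + Csh * M * (A₀ * nn * u + B₀ * (2 * u))) := by gcongr
    _ = _ := by ring

omit [FiniteDimensional ℝ E'] [MeasurableSpace E'] [BorelSpace E'] [FiniteDimensional ℝ F'] [Fintype ι] in
/-- `1/8 + 1/8 = 1/4`: the two smallness conditions give the contraction factor `1/4`. [folklore] -/
theorem le_quarter_of_parts {X L R : ℝ≥0∞} (h : X ≤ L + R) (hL : L ≤ ENNReal.ofReal 8⁻¹) (hR : R ≤ ENNReal.ofReal 8⁻¹) :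
    X ≤ ENNReal.ofReal 4⁻¹ := by
  refine h.trans ((add_le_add hL hR).trans ?_)
  rw [← ENNReal.ofReal_add (by norm_num) (by norm_num)]
  exact ENNReal.ofReal_le_ofReal (by norm_num)

omit [FiniteDimensional ℝ E'] [MeasurableSpace E'] [BorelSpace E'] [FiniteDimensional ℝ F'] [Fintype ι] in
/-- **Threshold arithmetic**: `D · λ⁻¹ ≤ c` once `λ ≥ (D + 1)/c` (`D` finite, `c > 0`). [folklore] -/
theorem mul_ofReal_inv_le_of_le {D : ℝ≥0∞} (hD : D ≠ ⊤) {c lam : ℝ} (hc : 0 < c) (hlam : (D.toReal + 1) / c ≤ lam) :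
    D * ENNReal.ofReal lam⁻¹ ≤ ENNReal.ofReal c := by
  have hl0 : 0 < lam := lt_of_lt_of_le (by positivity) hlam
  rw [← ENNReal.ofReal_toReal hD, ← ENNReal.ofReal_mul ENNReal.toReal_nonneg]
  refine ENNReal.ofReal_le_ofReal ?_
  rw [← div_eq_mul_inv, div_le_iff₀ hl0]
  have := (div_le_iff₀ hc).1 hlam
  nlinarith [ENNReal.toReal_nonneg (a := D)]

omit [FiniteDimensional ℝ E'] [MeasurableSpace E'] [BorelSpace E'] [FiniteDimensional ℝ F'] [Fintype ι] in
/-- **The number of steps from the tolerance**: `(1/4)^N G ≤ ε` for some `N` (`G` finite).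
[folklore] -/
theorem exists_quarter_pow_mul_le {G : ℝ≥0∞} (hG : G ≠ ⊤) {ε : ℝ} (hε : 0 < ε) :
    ∃ N : ℕ, (ENNReal.ofReal 4⁻¹) ^ N * G ≤ ENNReal.ofReal ε := by
  rcases eq_or_ne G 0 with hG0 | hG0
  · exact ⟨0, by simp [hG0]⟩
  have hpos : ENNReal.ofReal ε / G ≠ 0 := (ENNReal.div_pos (by simpa using hε) hG).ne'
  obtain ⟨N, hN⟩ := ENNReal.exists_inv_two_pow_lt hpos
  refine ⟨N, ?_⟩
  have h4 : (ENNReal.ofReal 4⁻¹) ^ N ≤ 2⁻¹ ^ N := by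
    refine pow_le_pow_left' ?_ N
    rw [← ENNReal.ofReal_ofNat 2, ← ENNReal.ofReal_inv_of_pos (by norm_num)]
    exact ENNReal.ofReal_le_ofReal (by norm_num)
  have h := (ENNReal.lt_div_iff_mul_lt (Or.inl hG0) (Or.inl hG)).1 (h4.trans_lt hN)
  exact h.le

omit [FiniteDimensional ℝ E'] [MeasurableSpace E'] [BorelSpace E'] [FiniteDimensional ℝ F'] [Fintype ι] in
/-- An operator norm bound from a bound of `‖A x‖²`. [folklore] -/
theorem opNorm_le_sqrt_of_sq_le (B : E' →L[ℝ] E') {c : ℝ} (hc : 0 ≤ c) (h : ∀ x, ‖B x‖ ^ 2 ≤ c * ‖x‖ ^ 2) :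
    ‖B‖ ≤ Real.sqrt c := by
  refine ContinuousLinearMap.opNorm_le_bound _ (Real.sqrt_nonneg _) fun x ↦ ?_
  rw [← Real.sqrt_sq (norm_nonneg (B x)), ← Real.sqrt_sq (norm_nonneg x), ← Real.sqrt_mul hc]
  exact Real.sqrt_le_sqrt (h x)

omit [MeasurableSpace E'] [BorelSpace E'] [FiniteDimensional ℝ F'] [Fintype ι] in
/-- **Conjugated symbols near the identity**: if `A X A† = 1` then
`‖A Y A† - 1‖ ≤ ‖A‖² ‖Y - X‖`. [folklore] -/
theorem norm_conj_sub_one_le (B X Y : E' →L[ℝ] E') (h : B ∘L X ∘L ContinuousLinearMap.adjoint B = 1) :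
    ‖B ∘L Y ∘L ContinuousLinearMap.adjoint B - 1‖ ≤ ‖B‖ ^ 2 * ‖Y - X‖ := by
  haveI : CompleteSpace E' := FiniteDimensional.complete ℝ E'
  have heq : B ∘L Y ∘L ContinuousLinearMap.adjoint B - 1 = B ∘L (Y - X) ∘L ContinuousLinearMap.adjoint B := by
    rw [← h, ContinuousLinearMap.sub_comp, ContinuousLinearMap.comp_sub]
  rw [heq]
  calc ‖B ∘L (Y - X) ∘L ContinuousLinearMap.adjoint B‖ ≤ ‖B‖ * ‖(Y - X) ∘L ContinuousLinearMap.adjoint B‖ :=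
        ContinuousLinearMap.opNorm_comp_le _ _
    _ ≤ ‖B‖ * (‖Y - X‖ * ‖ContinuousLinearMap.adjoint B‖) :=
        mul_le_mul_of_nonneg_left (ContinuousLinearMap.opNorm_comp_le _ _) (norm_nonneg _)
    _ = ‖B‖ ^ 2 * ‖Y - X‖ := by rw [ContinuousLinearMap.adjoint.norm_map]; ring

omit [FiniteDimensional ℝ E'] [MeasurableSpace E'] [BorelSpace E'] [FiniteDimensional ℝ F'] [Fintype ι] in
/-- `x² ≤ 1 + 2κ → x ≤ 1 + κ` (`κ ≥ 0`). [folklore] -/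
theorem le_one_add_of_sq_le {x κ : ℝ} (hκ : 0 ≤ κ) (h : x ^ 2 ≤ 1 + 2 * κ) : x ≤ 1 + κ := by
  nlinarith [sq_nonneg κ, sq_nonneg (x - 1 - κ)]

omit [FiniteDimensional ℝ E'] [MeasurableSpace E'] [BorelSpace E'] [FiniteDimensional ℝ F'] [Fintype ι] in
/-- Bump functions with the same radii coincide. [folklore] -/
theorem contDiffBump_eq {X : Type*} {c : X} (f g : ContDiffBump c) (h1 : f.rIn = g.rIn) (h2 : f.rOut = g.rOut) : f = g := by
  cases f; cases g
  simp only at h1 h2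
  subst h1; subst h2
  rfl

omit [FiniteDimensional ℝ E'] [MeasurableSpace E'] [BorelSpace E'] [FiniteDimensional ℝ F'] [Fintype ι] in
/-- `(1 + 1/(m+1))ᵐ ≤ 3`. [folklore] -/
theorem one_add_inv_pow_le_three (m : ℕ) : (1 + 1 / ((m : ℝ) + 1)) ^ m ≤ 3 := by
  have h1 : (1 + 1 / ((m : ℝ) + 1)) ^ m ≤ Real.exp (1 / ((m : ℝ) + 1)) ^ m :=
    pow_le_pow_left₀ (by positivity) (by linarith [Real.add_one_le_exp (1 / ((m : ℝ) + 1))]) m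
  refine h1.trans ?_
  rw [← Real.exp_nat_mul]
  have h2 : (m : ℝ) * (1 / ((m : ℝ) + 1)) ≤ 1 := by
    rw [mul_one_div, div_le_one (by positivity)]; linarith
  calc Real.exp ((m : ℝ) * (1 / ((m : ℝ) + 1))) ≤ Real.exp 1 := Real.exp_le_exp.2 h2
    _ ≤ 3 := by have := Real.exp_one_lt_d9; linarith

end FlatStep

/-! ### The flat approximate solution operator -/

set_option maxHeartbeats 1600000 in
open FlatStep in
/-- **The flat approximate solution operator with `λ`-gain bounds.** Let `S, 𝔟, 𝔠` be slab-smooth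
coefficient fields on `[0, T] × E'`, constant (`S = 1`, `𝔟 = 0`, `𝔠 = 0`) outside the ball of
radius `R_c`, with `S(0, y)` self-adjoint and `ν₀`-coercive, and with temporal oscillation
`‖S(s, y) - S(0, y)‖ ≤ ε_o` where `2 √C_n ε_o ≤ ν₀`, `C_n = 3840 n³ (10√n + 1)^{2n} n!`. Then for every
top order `K` and radius `ϱ ≥ 0` there are `Λ₀ ≥ 1` and finite `C_box, C_sup` such that for every
slab-smooth source `Θ` supported in `closedBall 0 ϱ` and every `ε > 0` there are slab-smooth `v, r`
with `v(0) = 0`,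
`∂ₜ v = frameOp (S s y) (𝔟 s y) (𝔠 s y) (v s) y + Θ - r` on the slab, `E_k(r(s)) ≤ ε` for
`k + 1 ≤ K`, and for all `λ ≥ Λ₀`, `k ≤ K`, `t, s ∈ [0, T]`:
`∫₀ᵗ e^{-2λs}(Σ_a E_k(∂_a v) + E_k(v)) ≤ C_box λ⁻¹ ∫₀ᵗ e^{-2λs} E_k(Θ)` and
`Σ_a E_k(∂_a v(s)) + E_k(v(s)) ≤ C_sup e^{2λs} ∫₀ˢ e^{-2λσ} E_k(Θ(σ)) dσ`.
[cite: Hormander1985III, §17.1] -/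
theorem exists_flatApproxSolve [Nontrivial E'] {T : ℝ} (hT : 0 < T)
    {S : ℝ → E' → (E' →L[ℝ] E')} {𝔟 : ℝ → E' → ((E' →L[ℝ] F') →L[ℝ] F')} {𝔠 : ℝ → E' → (F' →L[ℝ] F')}
    (hS : IsSmoothSpaceTimeOn (Icc 0 T) S) (h𝔟 : IsSmoothSpaceTimeOn (Icc 0 T) 𝔟) (h𝔠 : IsSmoothSpaceTimeOn (Icc 0 T) 𝔠)
    {Rc : ℝ} (hSc : ∀ s y, Rc ≤ ‖y‖ → S s y = 1) (h𝔟c : ∀ s y, Rc ≤ ‖y‖ → 𝔟 s y = 0)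
    (h𝔠c : ∀ s y, Rc ≤ ‖y‖ → 𝔠 s y = 0)
    (hsymm : ∀ y, ContinuousLinearMap.adjoint (S 0 y) = S 0 y)
    {ν₀ : ℝ} (hν₀ : 0 < ν₀) (hcoer : ∀ y ξ, ν₀ * ‖ξ‖ ^ 2 ≤ ⟪S 0 y ξ, ξ⟫)
    {εo : ℝ} (hosc : ∀ s ∈ Icc 0 T, ∀ y, ‖S s y - S 0 y‖ ≤ εo)
    (hεo : 2 * Real.sqrt (3840 * (Module.finrank ℝ E' : ℝ) ^ 3 *
      (10 * Real.sqrt (Module.finrank ℝ E') + 1) ^ (2 * Module.finrank ℝ E') * (Module.finrank ℝ E').factorial) * εo ≤ ν₀)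
    (K : ℕ) {ϱ : ℝ} (hϱ : 0 ≤ ϱ) :
    ∃ Λ₀ : ℝ, 1 ≤ Λ₀ ∧ ∃ Cbox Csup : ℝ≥0∞, Cbox ≠ ⊤ ∧ Csup ≠ ⊤ ∧
      ∀ {Θ : ℝ → E' → F'}, IsSmoothSpaceTimeOn (Icc 0 T) Θ → (∀ s y, Θ s y ≠ 0 → y ∈ closedBall (0 : E') ϱ) →
      ∀ {ε : ℝ}, 0 < ε → ∃ v r : ℝ → E' → F',
        IsSmoothSpaceTimeOn (Icc 0 T) v ∧ IsSmoothSpaceTimeOn (Icc 0 T) r ∧ (∀ y, v 0 y = 0) ∧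
        (∀ s ∈ Icc 0 T, ∀ y, timeDerivWithin (Icc 0 T) v s y =
            frameOp (S s y) (𝔟 s y) (𝔠 s y) (v s) y + Θ s y - r s y) ∧
        (∀ k, k + 1 ≤ K → ∀ s ∈ Icc 0 T, sobolevEnergy k (r s) ≤ ENNReal.ofReal ε) ∧
        (∀ {lam : ℝ}, Λ₀ ≤ lam → ∀ k ≤ K, ∀ t ∈ Icc 0 T,
            ∫⁻ s in Ioo 0 t, ENNReal.ofReal (Real.exp (-2 * lam * s)) *
                ((∑ a, sobolevEnergy k (fun y ↦ fderiv ℝ (v s) y (stdOrthonormalBasis ℝ E' a))) + sobolevEnergy k (v s)) ≤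
              Cbox * ENNReal.ofReal lam⁻¹ *
                ∫⁻ s in Ioo 0 t, ENNReal.ofReal (Real.exp (-2 * lam * s)) * sobolevEnergy k (Θ s)) ∧
        (∀ {lam : ℝ}, Λ₀ ≤ lam → ∀ k ≤ K, ∀ s ∈ Icc 0 T,
            (∑ a, sobolevEnergy k (fun y ↦ fderiv ℝ (v s) y (stdOrthonormalBasis ℝ E' a))) + sobolevEnergy k (v s) ≤
              Csup * ENNReal.ofReal (Real.exp (2 * lam * s)) *
                ∫⁻ σ in Ioo 0 s, ENNReal.ofReal (Real.exp (-2 * lam * σ)) * sobolevEnergy k (Θ σ)) := by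
  classical
  haveI : CompleteSpace E' := FiniteDimensional.complete ℝ E'
  /- ## numerology -/
  set n : ℕ := Module.finrank ℝ E' with hn
  have hnpos : 0 < n := Module.finrank_pos
  have hn0 : (0 : ℝ) < n := by exact_mod_cast hnpos
  set sn : ℝ := Real.sqrt n with hsn
  have hsn0 : 0 < sn := Real.sqrt_pos.2 hn0
  set Cn : ℝ := 3840 * (n : ℝ) ^ 3 * (10 * sn + 1) ^ (2 * n) * (n.factorial : ℝ) with hCn
  have hfact1 : (1 : ℝ) ≤ n.factorial := by exact_mod_cast Nat.succ_le_of_lt (Nat.factorial_pos n)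
  have hCn1 : 1 ≤ Cn := by
    have h1 : (1 : ℝ) ≤ (n : ℝ) ^ 3 := one_le_pow₀ (by exact_mod_cast hnpos)
    have h2 : (1 : ℝ) ≤ (10 * sn + 1) ^ (2 * n) := one_le_pow₀ (by linarith)
    have h : (1 : ℝ) * 1 * 1 ≤ (n : ℝ) ^ 3 * (10 * sn + 1) ^ (2 * n) * (n.factorial : ℝ) :=
      mul_le_mul (mul_le_mul h1 h2 zero_le_one (by positivity)) hfact1 zero_le_one (by positivity)
    rw [hCn]; linarith
  have hCn0 : 0 < Cn := one_pos.trans_le hCn1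
  have hsq : 0 < Real.sqrt Cn := Real.sqrt_pos.2 hCn0
  have hεo0 : 0 ≤ εo := by
    have h := hosc 0 ⟨le_rfl, hT.le⟩ 0
    rwa [sub_self, norm_zero] at h
  set εω : ℝ := ν₀ / (2 * Real.sqrt Cn) with hεω
  have hεω0 : 0 < εω := by positivity
  have hεole : εo ≤ εω := by
    rw [hεω, le_div_iff₀ (by positivity)]
    linarith
  set η : ℝ := ν₀⁻¹ * (εo + εω) with hη
  have hη0 : 0 ≤ η := by positivity
  have hηle : η ≤ 1 / Real.sqrt Cn := by
    have h1 : η ≤ ν₀⁻¹ * (2 * εω) := by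
      rw [hη]; exact mul_le_mul_of_nonneg_left (by linarith) (inv_nonneg.2 hν₀.le)
    refine h1.trans (le_of_eq ?_)
    rw [hεω]
    field_simp
  have hCnη : Cn * η ^ 2 ≤ 1 := by
    have h1 : η ^ 2 ≤ (1 / Real.sqrt Cn) ^ 2 := pow_le_pow_left₀ hη0 hηle 2
    rw [div_pow, one_pow, Real.sq_sqrt hCn0.le] at h1
    calc Cn * η ^ 2 ≤ Cn * (1 / Cn) := mul_le_mul_of_nonneg_left h1 hCn0.le
      _ = 1 := by field_simp
  have hη1 : η ≤ 1 := by
    refine hηle.trans ?_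
    rw [div_le_one hsq]
    exact Real.one_le_sqrt.2 hCn1
  -- the near-isometry parameter
  obtain ⟨κ, hκ⟩ : ∃ κ : ℝ, κ = 1 / (((2 * K + n : ℕ) : ℝ) + 1) := ⟨_, rfl⟩
  have hκ0 : 0 < κ := by rw [hκ]; positivity
  have hκ3 : ((1 + κ) ^ 2) ^ K * (1 + κ) ^ n ≤ 3 := by
    have h1 : ((1 + κ) ^ 2) ^ K * (1 + κ) ^ n = (1 + κ) ^ (2 * K + n) := by rw [← pow_mul, ← pow_add]
    rw [h1, hκ]
    exact one_add_inv_pow_le_three (2 * K + n)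
  /- ## moduli of continuity of `S(0, ·)` and the mesh -/
  have hS0c : Continuous (S 0) := (hS.contDiff_slice ⟨le_rfl, hT.le⟩).continuous
  obtain ⟨δω, hδω0, hδω⟩ := exists_modulus_of_eventually_const hS0c (fun y hy ↦ hSc 0 y hy) hεω0
  obtain ⟨δκ, hδκ0, hδκ⟩ := exists_modulus_of_eventually_const hS0c (fun y hy ↦ hSc 0 y hy) (ε := 2 * κ * ν₀) (by positivity)
  obtain ⟨δ, hδ0, h4r, h5r⟩ : ∃ δ : ℝ, 0 < δ ∧ 4 * (sn * δ) ≤ δω ∧ 5 * (sn * δ) ≤ δκ := by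
    refine ⟨min (δω / (4 * sn)) (δκ / (5 * sn)), lt_min (by positivity) (by positivity), ?_, ?_⟩
    · calc 4 * (sn * min (δω / (4 * sn)) (δκ / (5 * sn))) ≤ 4 * (sn * (δω / (4 * sn))) := by
            gcongr; exact min_le_left _ _
        _ = δω := by field_simp
    · calc 5 * (sn * min (δω / (4 * sn)) (δκ / (5 * sn))) ≤ 5 * (sn * (δκ / (5 * sn))) := by
            gcongr; exact min_le_right _ _
        _ = δκ := by field_simp
  set r : ℝ := sn * δ with hr
  have hr0 : 0 < r := by positivity
  /- ## coefficient bounds and frames -/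
  obtain ⟨MS, hMS0, hMS⟩ := exists_forall_iteratedFDeriv_slab_le hT hS hSc (K + 2)
  obtain ⟨M𝔟, -, hM𝔟⟩ := exists_forall_iteratedFDeriv_slab_le hT h𝔟 h𝔟c (K + 2)
  obtain ⟨M𝔠, -, hM𝔠⟩ := exists_forall_iteratedFDeriv_slab_le hT h𝔠 h𝔠c (K + 2)
  have hS0n : ∀ y, ‖S 0 y‖ ≤ MS := fun y ↦ by
    have h := hMS 0 ⟨le_rfl, hT.le⟩ 0 (Nat.zero_le _) y
    rwa [norm_iteratedFDeriv_zero] at h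
  have hfr : ∀ c : E', ∃ Ac : E' ≃L[ℝ] E', (∀ x, Ac (S 0 c (Ac x)) = x) ∧
      ContinuousLinearMap.adjoint (Ac : E' →L[ℝ] E') = Ac ∧
      (∀ x, ‖Ac x‖ ^ 2 ≤ ν₀⁻¹ * ‖x‖ ^ 2) ∧ (∀ x, ‖Ac.symm x‖ ^ 2 ≤ ‖S 0 c‖ * ‖x‖ ^ 2) := fun c ↦
    exists_symbolFrame ((ContinuousLinearMap.isSelfAdjoint_iff'.2 (hsymm c)).isSymmetric) hν₀ (hcoer c)
  choose Af hAf1 hAf2 hAf3 hAf4 using hfr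
  set a₁ : ℝ := max 1 (Real.sqrt ν₀⁻¹) with ha₁
  set a₂ : ℝ := max 1 (Real.sqrt MS) with ha₂
  have ha₁1 : 1 ≤ a₁ := le_max_left _ _
  have ha₂1 : 1 ≤ a₂ := le_max_left _ _
  have hAfn : ∀ c, ‖(Af c : E' →L[ℝ] E')‖ ≤ Real.sqrt ν₀⁻¹ := fun c ↦
    opNorm_le_sqrt_of_sq_le _ (inv_nonneg.2 hν₀.le) (hAf3 c)
  have hAfn2 : ∀ c, ‖(Af c : E' →L[ℝ] E')‖ ^ 2 ≤ ν₀⁻¹ := fun c ↦ by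
    have h := pow_le_pow_left₀ (norm_nonneg _) (hAfn c) 2
    rwa [Real.sq_sqrt (inv_nonneg.2 hν₀.le)] at h
  have hAfa₁ : ∀ c, ‖(Af c : E' →L[ℝ] E')‖ ≤ a₁ := fun c ↦ (hAfn c).trans (le_max_right _ _)
  have hAfa₂ : ∀ c, ‖((Af c).symm : E' →L[ℝ] E')‖ ≤ a₂ := fun c ↦ by
    refine (opNorm_le_sqrt_of_sq_le _ hMS0 fun x ↦ (hAf4 c x).trans ?_).trans (le_max_right _ _)
    exact mul_le_mul_of_nonneg_right (hS0n c) (sq_nonneg _)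
  have hAf1' : ∀ c, (Af c : E' →L[ℝ] E') ∘L S 0 c ∘L ContinuousLinearMap.adjoint (Af c : E' →L[ℝ] E') = 1 :=
    fun c ↦ frame_comp_eq_one (hAf1 c) (hAf2 c)
  /- ## the profile and the model cut-offs -/
  have hρ₀s : ContDiff ℝ ∞ (latticeProfile (E' := E') hδ0) := contDiff_latticeProfile hδ0
  have hρ₀c : HasCompactSupport (latticeProfile (E' := E') hδ0) := by
    refine HasCompactSupport.intro (isCompact_closedBall (0 : E') (2 * (Real.sqrt (Module.finrank ℝ E') * δ)))
      fun x hx ↦ ?_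
    refine image_eq_zero_of_notMem_tsupport fun h ↦ hx ?_
    exact ball_subset_closedBall (tsupport_latticeProfile_subset hδ0 h)
  obtain ⟨Mρ, hMρ0, hMρ⟩ := exists_bound_iteratedFDeriv_of_hasCompactSupport hρ₀s hρ₀c K
  have hMρ0' : ∀ x, |latticeProfile (E' := E') hδ0 x| ≤ Mρ := fun x ↦ by
    have h := hMρ x 0 (Nat.zero_le _)
    rwa [norm_iteratedFDeriv_zero, Real.norm_eq_abs] at h
  have hMρw' : ∀ lst : List (Fin (Module.finrank ℝ E')), lst ≠ [] → lst.length ≤ K →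
      ∀ x, ‖iterDirDeriv (lst.map (stdOrthonormalBasis ℝ E')) (latticeProfile (E' := E') hδ0) x‖ ≤ Mρ :=
    fun lst _ hl x ↦ (norm_iterDirDeriv_frame_le hρ₀s lst x).trans (hMρ x _ hl)
  set b0 : ContDiffBump (0 : E') := ⟨2 * r, 3 * r, by linarith, by linarith⟩ with hb0
  set bP0 : ContDiffBump (0 : E') := ⟨3 * r, 4 * r, by linarith, by linarith⟩ with hbP0
  obtain ⟨Mb', -, hMb'⟩ := exists_bound_iteratedFDeriv_of_hasCompactSupport b0.contDiff b0.hasCompactSupport (K + 2)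
  obtain ⟨MbP', -, hMbP'⟩ := exists_bound_iteratedFDeriv_of_hasCompactSupport bP0.contDiff bP0.hasCompactSupport (K + 2)
  set Mb : ℝ := max 1 Mb' with hMbdef
  set MbP : ℝ := max 1 MbP' with hMbPdef
  have hMb1 : 1 ≤ Mb := le_max_left _ _
  have hMbP1 : 1 ≤ MbP := le_max_left _ _
  have hMb : ∀ m ≤ K + 2, ∀ x, ‖iteratedFDeriv ℝ m b0 x‖ ≤ Mb := fun m hm x ↦ (hMb' x m hm).trans (le_max_right _ _)
  have hMbP : ∀ m ≤ K + 2, ∀ x, ‖iteratedFDeriv ℝ m bP0 x‖ ≤ MbP := fun m hm x ↦ (hMbP' x m hm).trans (le_max_right _ _)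
  /- ## the constants of the estimates -/
  -- slice constants
  have hB : ∀ k, ∃ B₀ : ℝ≥0∞, B₀ ≠ ⊤ ∧ (k ≤ K → ∀ {ι : Type} [Fintype ι] (Q : FlatPatches E' ι) (A : ι → E' ≃L[ℝ] E'),
      (∀ i, ‖(A i : E' →L[ℝ] E')‖ ≤ a₁) → (∀ i, ‖((A i).symm : E' →L[ℝ] E')‖ ≤ a₂) →
      (∀ m ≤ K + 2, ∀ x, ‖iteratedFDeriv ℝ m (cut0 Q) x‖ ≤ Mb) →
      (∀ m ≤ K + 2, ∀ x, ‖iteratedFDeriv ℝ m (cutP0 Q) x‖ ≤ MbP) →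
      (∀ i, ∀ s ∈ Icc 0 T, ∀ z ∈ tsupport (cutPAd Q A i), ‖Sad Q A S i s z - 1‖ ≤ η) →
      ∀ Θ : ℝ → E' → F', IsSmoothSpaceTimeOn (Icc 0 T) Θ → ∀ i, ∀ s ∈ Icc 0 T,
      sobolevEnergy k (errAd Q A T S 𝔟 𝔠 Θ i s) ≤
        ENNReal.ofReal (80 * (Module.finrank ℝ E' : ℝ) ^ 2 * η ^ 2) * ∑ a, ∑ l,
            sobolevEnergy k (fun y ↦ fderiv ℝ (fun z ↦ fderiv ℝ (wAd Q A T Θ i s) z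
              (stdOrthonormalBasis ℝ E' l)) y (stdOrthonormalBasis ℝ E' a)) +
          B₀ * (∑ l, sobolevEnergy k (fun z ↦ fderiv ℝ (wAd Q A T Θ i s) z (stdOrthonormalBasis ℝ E' l)) +
            sobolevEnergy k (wAd Q A T Θ i s))) := by
    intro k
    by_cases hk : k ≤ K
    · obtain ⟨B₀, hB₀top, hB₀⟩ := flat_hslice (F' := F') hT hS h𝔟 h𝔠 ha₁1 ha₂1 hMb1 hMbP1 hMS hM𝔟 hM𝔠 hη0 hη1 k hk
      exact ⟨B₀, hB₀top, fun _ ι _ Q A ha₁ ha₂ hb hbP hηQ Θ hΘ i s hs ↦ hB₀ Q A ha₁ ha₂ hb hbP hηQ Θ hΘ i s hs⟩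
    · exact ⟨0, ENNReal.zero_ne_top, fun h ↦ absurd h hk⟩
  choose B₀ hB₀top hB₀ using hB
  -- sharp and crude product constants
  have hsh := fun k ↦ sobolevEnergy_smul_le_sharp_one (E' := E') (F' := F') k
  choose Csh hCshtop hCsh0 hCsh using hsh
  have hcr := fun k ↦ sobolevEnergy_smul_le_crude (E := E') (F := F') (k + 1)
  choose Ccr hCcrtop hCcr using hcr
  -- data transport constants
  have hCdex : ∀ k, ∃ Cd : ℝ≥0∞, Cd ≠ ⊤ ∧ (k ≤ K → ∀ {ι : Type} [Fintype ι] (Q : FlatPatches E' ι) (A : ι → E' ≃L[ℝ] E'),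
      (∀ i, ‖(A i : E' →L[ℝ] E')‖ ≤ a₁) → (∀ i, ‖((A i).symm : E' →L[ℝ] E')‖ ≤ a₂) →
      (∀ i x, Q.ρ i x = latticeProfile hδ0 (x - Q.c i)) →
      ∀ {Θs : E' → F'}, ContDiff ℝ ∞ Θs → ∀ i,
        sobolevEnergy k (fun z ↦ Q.ρ i (psi Q A i z) • Θs (psi Q A i z)) ≤ Cd * sobolevEnergy k Θs) := by
    intro k
    by_cases hk : k ≤ K
    · obtain ⟨Cd, hCdtop, hCd⟩ := sobolevEnergy_dataAd_le (E' := E') (F' := F') K (a₁ := a₁) (a₂ := a₂) (Mρ := Mρ) k hk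
      exact ⟨Cd, hCdtop, fun _ ι _ Q A ha₁ ha₂ hQρ Θs hΘs i ↦ hCd Q A ha₁ ha₂ hρ₀s hQρ hMρ0' hMρw' hΘs i⟩
    · exact ⟨0, ENNReal.zero_ne_top, fun h ↦ absurd h hk⟩
  choose Cd hCdtop hCd₀ using hCdex
  -- transport and counting constants
  set Cpush : ℝ≥0∞ := ENNReal.ofReal (max 1 (a₁ ^ 2) ^ (K + 1) * ((n.factorial : ℝ) * a₂ ^ n)) with hCpush
  set Ctr : ℝ≥0∞ := ENNReal.ofReal (((1 + κ) ^ 2) ^ K * ((n.factorial : ℝ) * (1 + κ) ^ n)) with hCtr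
  set mm : ℝ≥0∞ := ENNReal.ofReal ((2 * (5 * r) / δ + 1) ^ n) with hmm
  set m₃ : ℝ≥0∞ := ENNReal.ofReal ((2 * (3 * r) / δ + 1) ^ n) with hm₃
  set cnt : ℝ≥0∞ := ENNReal.ofReal ((2 * (ϱ + 2 * r) / δ + 1) ^ n) with hcnt
  set Mv : ℝ := a₂ ^ (K + 2) * Mb with hMv
  have hMv1 : 1 ≤ Mv := one_le_mul_of_one_le_of_one_le (one_le_pow₀ ha₂1) hMb1
  set Mρw : ℝ := a₂ ^ K * Mρ with hMρw
  set A₀ : ℝ≥0∞ := ENNReal.ofReal (80 * (n : ℝ) ^ 2 * η ^ 2) with hA₀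
  set Bk : ℕ → ℝ≥0∞ := fun k ↦ B₀ k + B₀ (k - 1) with hBk
  have hBktop : ∀ k, Bk k ≠ ⊤ := fun k ↦ ENNReal.add_ne_top.2 ⟨hB₀top k, hB₀top _⟩
  set D : ℕ → ℝ≥0∞ := fun k ↦ mm ^ 2 * Ctr * (4 * Bk k + Csh k * ENNReal.ofReal (Mρw ^ 2) * (A₀ * (n : ℝ≥0∞) + 2 * Bk k)) with hD
  have hDtop : ∀ k, D k ≠ ⊤ := by
    intro k
    refine ENNReal.mul_ne_top (ENNReal.mul_ne_top (ENNReal.pow_ne_top ENNReal.ofReal_ne_top) ENNReal.ofReal_ne_top) ?_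
    refine ENNReal.add_ne_top.2 ⟨ENNReal.mul_ne_top (by norm_num) (hBktop k), ENNReal.mul_ne_top
      (ENNReal.mul_ne_top (hCshtop k) ENNReal.ofReal_ne_top) (ENNReal.add_ne_top.2 ⟨ENNReal.mul_ne_top ENNReal.ofReal_ne_top
        (ENNReal.natCast_ne_top n), ENNReal.mul_ne_top (by norm_num) (hBktop k)⟩)⟩
  set Λ : ℝ := 1 + ∑ k ∈ Finset.range (K + 1), 8 * ((D k).toReal + 1) with hΛ
  have hΛ1 : 1 ≤ Λ := le_add_of_nonneg_right (Finset.sum_nonneg fun k _ ↦ by positivity)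
  have hΛ0 : 0 < Λ := one_pos.trans_le hΛ1
  have hΛk : ∀ k ≤ K, ∀ {lam : ℝ}, Λ ≤ lam → ((D k).toReal + 1) / 8⁻¹ ≤ lam := by
    intro k hk lam hlam
    refine le_trans ?_ hlam
    rw [div_inv_eq_mul, mul_comm]
    have h := Finset.single_le_sum (f := fun k ↦ 8 * ((D k).toReal + 1)) (fun _ _ ↦ by positivity)
      (Finset.mem_range.2 (Nat.lt_succ_of_le hk))
    linarith
  set Cone : ℕ → ℝ≥0∞ := fun k ↦ m₃ * (Cpush * (Ccr k * ENNReal.ofReal (Mv ^ 2))) with hCone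
  have hConetop : ∀ k, Cone k ≠ ⊤ := fun k ↦ ENNReal.mul_ne_top ENNReal.ofReal_ne_top
    (ENNReal.mul_ne_top ENNReal.ofReal_ne_top (ENNReal.mul_ne_top (hCcrtop k) ENNReal.ofReal_ne_top))
  set Cbox : ℝ≥0∞ := ∑ k ∈ Finset.range (K + 1), 16 * Cone k * (cnt * Cd k) with hCbox
  set Csup : ℝ≥0∞ := ∑ k ∈ Finset.range (K + 1), 8 * Cone k * ((n : ℝ≥0∞) + 1) * (cnt * Cd k) with hCsup
  have hCboxtop : Cbox ≠ ⊤ := ENNReal.sum_ne_top.2 fun k _ ↦ ENNReal.mul_ne_top (ENNReal.mul_ne_top (by norm_num) (hConetop k))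
    (ENNReal.mul_ne_top ENNReal.ofReal_ne_top (hCdtop k))
  have hCsuptop : Csup ≠ ⊤ := ENNReal.sum_ne_top.2 fun k _ ↦ ENNReal.mul_ne_top (ENNReal.mul_ne_top
    (ENNReal.mul_ne_top (by norm_num) (hConetop k)) (ENNReal.add_ne_top.2 ⟨ENNReal.natCast_ne_top n, ENNReal.one_ne_top⟩))
    (ENNReal.mul_ne_top ENNReal.ofReal_ne_top (hCdtop k))
  -- the `λ`-independent part of the one-step factor is `≤ 1/8`
  have hL : mm ^ 2 * Ctr * (2 * A₀ * (n : ℝ≥0∞)) ≤ ENNReal.ofReal 8⁻¹ := by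
    rw [hmm, hCtr, hA₀, ofReal_sq_mul_mul_eq (by positivity) (by positivity) (by positivity)]
    refine ENNReal.ofReal_le_ofReal ?_
    have hx : 2 * (5 * r) / δ + 1 = 10 * sn + 1 := by rw [hr]; field_simp; ring
    rw [hx, ← pow_mul]
    have h3 : ((1 + κ) ^ 2) ^ K * ((n.factorial : ℝ) * (1 + κ) ^ n) ≤ 3 * n.factorial := by
      calc ((1 + κ) ^ 2) ^ K * ((n.factorial : ℝ) * (1 + κ) ^ n)
          = (n.factorial : ℝ) * (((1 + κ) ^ 2) ^ K * (1 + κ) ^ n) := by ring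
        _ ≤ (n.factorial : ℝ) * 3 := mul_le_mul_of_nonneg_left hκ3 (by positivity)
        _ = 3 * n.factorial := by ring
    calc (10 * sn + 1) ^ (n * 2) * (((1 + κ) ^ 2) ^ K * ((n.factorial : ℝ) * (1 + κ) ^ n)) *
          (2 * (80 * (n : ℝ) ^ 2 * η ^ 2) * n)
        ≤ (10 * sn + 1) ^ (n * 2) * (3 * n.factorial) * (2 * (80 * (n : ℝ) ^ 2 * η ^ 2) * n) := by gcongr
      _ = Cn * η ^ 2 / 8 := by rw [hCn, mul_comm n 2]; ring
      _ ≤ 8⁻¹ := by rw [div_le_iff₀ (by norm_num : (0 : ℝ) < 8)]; linarith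
  refine ⟨Λ, hΛ1, Cbox, Csup, hCboxtop, hCsuptop, ?_⟩
  intro Θ hΘ hΘϱ ε hε
  /- ## the data and the number of steps -/
  have hΘK : ∀ s, ∀ y ∉ closedBall (0 : E') ϱ, Θ s y = 0 := fun s y hy ↦ by
    by_contra h; exact hy (hΘϱ s y h)
  have hCΘex := fun k ↦ exists_sobolevEnergy_slab_le hT hΘ (isCompact_closedBall 0 ϱ) hΘK k
  choose CΘ hCΘtop hCΘ using hCΘex
  set G : ℝ≥0∞ := ∑ k ∈ Finset.range K, m₃ * Cpush * (ENNReal.ofReal (Real.exp (2 * Λ * T)) *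
      (A₀ * ((n : ℝ≥0∞) * (n : ℝ≥0∞)) + Bk k * ((n : ℝ≥0∞) + 1))) * (cnt * (Cd (k + 1) * CΘ (k + 1) * ENNReal.ofReal T)) with hG
  have hGtop : G ≠ ⊤ := by
    refine ENNReal.sum_ne_top.2 fun k _ ↦ ENNReal.mul_ne_top (ENNReal.mul_ne_top (ENNReal.mul_ne_top ENNReal.ofReal_ne_top
      ENNReal.ofReal_ne_top) (ENNReal.mul_ne_top ENNReal.ofReal_ne_top (ENNReal.add_ne_top.2 ⟨?_, ?_⟩))) ?_
    · exact ENNReal.mul_ne_top ENNReal.ofReal_ne_top (ENNReal.mul_ne_top (ENNReal.natCast_ne_top n) (ENNReal.natCast_ne_top n))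
    · exact ENNReal.mul_ne_top (hBktop k) (ENNReal.add_ne_top.2 ⟨ENNReal.natCast_ne_top n, ENNReal.one_ne_top⟩)
    · exact ENNReal.mul_ne_top ENNReal.ofReal_ne_top (ENNReal.mul_ne_top (ENNReal.mul_ne_top (hCdtop _) (hCΘtop _))
        ENNReal.ofReal_ne_top)
  obtain ⟨N₀, hN₀⟩ := exists_quarter_pow_mul_le hGtop hε
  set N : ℕ := N₀ + 1 with hN
  /- ## the lattice patches and the frames -/
  obtain ⟨ι, hι, Q, hQr, hQmesh, hQreg, -, hQρ⟩ := exists_flatPatches_translate (E' := E') hδ0 (ϱ + 5 * N * r)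
  have hQr' : Q.r = r := hQr
  set A : ι → E' ≃L[ℝ] E' := fun i ↦ Af (Q.c i) with hA
  have ha₁ : ∀ i, ‖(A i : E' →L[ℝ] E')‖ ≤ a₁ := fun i ↦ hAfa₁ _
  have ha₂ : ∀ i, ‖((A i).symm : E' →L[ℝ] E')‖ ≤ a₂ := fun i ↦ hAfa₂ _
  have hcut0 : cut0 Q = b0 := contDiffBump_eq _ _ (by change 2 * Q.r = 2 * r; rw [hQr']) (by change 3 * Q.r = 3 * r; rw [hQr'])
  have hcutP0 : cutP0 Q = bP0 :=
    contDiffBump_eq _ _ (by change 3 * Q.r = 3 * r; rw [hQr']) (by change 4 * Q.r = 4 * r; rw [hQr'])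
  have hMbQ : ∀ m ≤ K + 2, ∀ x, ‖iteratedFDeriv ℝ m (cut0 Q) x‖ ≤ Mb := by rw [hcut0]; exact hMb
  have hMbPQ : ∀ m ≤ K + 2, ∀ x, ‖iteratedFDeriv ℝ m (cutP0 Q) x‖ ≤ MbP := by rw [hcutP0]; exact hMbP
  -- `η`-closeness of the adapted symbols
  have hηQ : ∀ i, ∀ s ∈ Icc 0 T, ∀ z ∈ tsupport (cutPAd Q A i), ‖Sad Q A S i s z - 1‖ ≤ η := by
    intro i s hs z hz
    have hy : psi Q A i z ∈ closedBall (Q.c i) (4 * Q.r) := by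
      have hc : Continuous (psi Q A i) := (contDiff_psi i).continuous
      exact Q.tsupport_cutPlus_subset i (hc.closure_preimage_subset (support (Q.cutPlus i)) hz)
    have hdist : dist (psi Q A i z) (Q.c i) ≤ δω := by
      rw [mem_closedBall, hQr'] at hy; linarith
    calc ‖Sad Q A S i s z - 1‖ ≤ ‖(A i : E' →L[ℝ] E')‖ ^ 2 * ‖S s (psi Q A i z) - S 0 (Q.c i)‖ :=
          norm_conj_sub_one_le _ _ _ (hAf1' (Q.c i))
      _ ≤ ν₀⁻¹ * (εo + εω) := by
          refine mul_le_mul (hAfn2 _) ?_ (norm_nonneg _) (inv_nonneg.2 hν₀.le)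
          calc ‖S s (psi Q A i z) - S 0 (Q.c i)‖
              ≤ ‖S s (psi Q A i z) - S 0 (psi Q A i z)‖ + ‖S 0 (psi Q A i z) - S 0 (Q.c i)‖ := norm_sub_le_norm_sub_add_norm_sub _ _ _
            _ ≤ εo + εω := add_le_add (hosc s hs _) (hδω _ _ hdist)
      _ = η := by rw [hη]
  -- near-isometry of neighbouring frames
  have hκQ : ∀ j, ∀ i ∈ nbrs Q j, ‖(A i : E' →L[ℝ] E') ∘L ((A j).symm : E' →L[ℝ] E')‖ ≤ 1 + κ := by
    intro j i hij
    have hd : dist (Q.c j) (Q.c i) ≤ δκ := ((mem_nbrs Q).1 hij).trans (by rw [hQr']; linarith)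
    have h1 := norm_sq_frame_comp_symm_le (hsymm (Q.c j)) (hAf1' (Q.c j)) (hAf1' (Q.c i))
    refine le_one_add_of_sq_le hκ0.le (h1.trans ?_)
    calc 1 + ‖(Af (Q.c i) : E' →L[ℝ] E')‖ ^ 2 * ‖S 0 (Q.c j) - S 0 (Q.c i)‖ ≤ 1 + ν₀⁻¹ * (2 * κ * ν₀) :=
          add_le_add le_rfl (mul_le_mul (hAfn2 _) (hδκ _ _ hd) (norm_nonneg _) (inv_nonneg.2 hν₀.le))
      _ = 1 + 2 * κ := by field_simp
  -- the uniform hypotheses of the estimates on this family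
  have hρw : ∀ j, ∀ lst : List (Fin (Module.finrank ℝ E')), lst ≠ [] → lst.length ≤ K →
      ∀ z, ‖iterDirDeriv (lst.map (stdOrthonormalBasis ℝ E')) (fun z ↦ Q.ρ j (psi Q A j z)) z‖ ≤ Mρw :=
    fun j lst _ hl z ↦ flat_hρw hρ₀s hQρ ha₂ ha₂1 (fun m hm x ↦ hMρ x m hm) j lst hl z
  have htr : ∀ k ≤ K, ∀ j, ∀ i ∈ nbrs Q j, ∀ k' ≤ k,
      ENNReal.ofReal (max 1 (‖((A i : E' →L[ℝ] E') ∘L ((A j).symm : E' →L[ℝ] E'))‖ ^ 2) ^ k' *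
        |(LinearMap.det (((A i : E' →L[ℝ] E') ∘L ((A j).symm : E' →L[ℝ] E') : E' →L[ℝ] E') : E' →ₗ[ℝ] E'))⁻¹|) ≤ Ctr :=
    fun k hk j i hi k' hk' ↦ flat_htr hκ0.le hκQ hk j i hi k' hk'
  have hpush : ∀ k ≤ K + 1, ∀ i, ENNReal.ofReal (max 1 (‖(A i : E' →L[ℝ] E')‖ ^ 2) ^ k *
      |(LinearMap.det ((A i : E' →L[ℝ] E') : E' →ₗ[ℝ] E'))⁻¹|) ≤ Cpush :=
    fun k hk i ↦ flat_hpush ha₁ ha₂ hk i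
  have hMv0 : ∀ i z, |cutAd Q A i z| ≤ Mv := fun i z ↦ (abs_cutAd_le_one i z).trans hMv1
  have hMvw : ∀ k ≤ K + 1, ∀ i, ∀ l : List (Fin (Module.finrank ℝ E')), l ≠ [] → l.length ≤ k →
      ∀ z, ‖iterDirDeriv (l.map (stdOrthonormalBasis ℝ E')) (cutAd Q A i) z‖ ≤ Mv := by
    intro k hk i l _ hl z
    refine (cutAd_word_le ha₂ i l (hMbQ l.length (by omega)) z).trans ?_
    exact mul_le_mul_of_nonneg_right (pow_le_pow_right₀ ha₂1 (by omega)) (by linarith)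
  have hslice : ∀ k ≤ K, ∀ Θ' : ℝ → E' → F', IsSmoothSpaceTimeOn (Icc 0 T) Θ' → ∀ i, ∀ s ∈ Icc 0 T,
      sobolevEnergy k (errAd Q A T S 𝔟 𝔠 Θ' i s) ≤
        A₀ * ∑ a, ∑ l, sobolevEnergy k (fun y ↦ fderiv ℝ (fun z ↦ fderiv ℝ (wAd Q A T Θ' i s) z
          (stdOrthonormalBasis ℝ E' l)) y (stdOrthonormalBasis ℝ E' a)) +
        Bk k * (∑ l, sobolevEnergy k (fun z ↦ fderiv ℝ (wAd Q A T Θ' i s) z (stdOrthonormalBasis ℝ E' l)) +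
          sobolevEnergy k (wAd Q A T Θ' i s)) := by
    intro k hk Θ' hΘ' i s hs
    refine (hB₀ k hk Q A ha₁ ha₂ hMbQ hMbPQ hηQ Θ' hΘ' i s hs).trans ?_
    exact add_le_add le_rfl (mul_le_mul' le_self_add le_rfl)
  have hslice' : ∀ k ≤ K, ∀ Θ' : ℝ → E' → F', IsSmoothSpaceTimeOn (Icc 0 T) Θ' → ∀ i, ∀ s ∈ Icc 0 T,
      sobolevEnergy (k - 1) (errAd Q A T S 𝔟 𝔠 Θ' i s) ≤
        A₀ * ∑ a, ∑ l, sobolevEnergy (k - 1) (fun y ↦ fderiv ℝ (fun z ↦ fderiv ℝ (wAd Q A T Θ' i s) z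
          (stdOrthonormalBasis ℝ E' l)) y (stdOrthonormalBasis ℝ E' a)) +
        Bk k * (∑ l, sobolevEnergy (k - 1) (fun z ↦ fderiv ℝ (wAd Q A T Θ' i s) z (stdOrthonormalBasis ℝ E' l)) +
          sobolevEnergy (k - 1) (wAd Q A T Θ' i s)) := by
    intro k hk Θ' hΘ' i s hs
    refine (hB₀ (k - 1) (by omega) Q A ha₁ ha₂ hMbQ hMbPQ hηQ Θ' hΘ' i s hs).trans ?_
    exact add_le_add le_rfl (mul_le_mul' le_add_self le_rfl)
  have hCd : ∀ k ≤ K, ∀ Θ' : ℝ → E' → F', IsSmoothSpaceTimeOn (Icc 0 T) Θ' → ∀ i, ∀ s ∈ Icc 0 T,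
      sobolevEnergy k (dataAd Q A Θ' i s) ≤ Cd k * sobolevEnergy k (Θ' s) :=
    fun k hk Θ' hΘ' i s hs ↦ hCd₀ k hk Q A ha₁ ha₂ hQρ (hΘ'.contDiff_slice hs) i
  /- ## one step contracts by `1/4` -/
  have hstep : ∀ k ≤ K, ∀ {lam : ℝ}, Λ ≤ lam → ∀ {t : ℝ}, t ∈ Icc 0 T → ∀ Θ' : ℝ → E' → F',
      IsSmoothSpaceTimeOn (Icc 0 T) Θ' →
      ∑ j, ∫⁻ s in Ioo 0 t, ENNReal.ofReal (Real.exp (-2 * lam * s)) *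
          sobolevEnergy k (dataAd Q A (errOne Q A T S 𝔟 𝔠 Θ') j s) ≤
        ENNReal.ofReal 4⁻¹ * ∑ i, ∫⁻ s in Ioo 0 t, ENNReal.ofReal (Real.exp (-2 * lam * s)) *
          sobolevEnergy k (dataAd Q A Θ' i s) := by
    intro k hk lam hlam t ht Θ' hΘ'
    have hl1 : 1 ≤ lam := hΛ1.trans hlam
    have hl0 : 0 < lam := one_pos.trans_le hl1
    have h := lintegral_weight_sum_dataAd_errOne_le Q A T S 𝔟 𝔠 Θ' hT hΘ' hS h𝔟 h𝔠 k (hCsh k) (hCsh0 k)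
      (hslice k hk Θ' hΘ') (hslice' k hk Θ' hΘ') (fun j lst hne hl z ↦ hρw j lst hne (hl.trans hk) z) (htr k hk) hl0 ht
    rw [hQr', hQmesh] at h
    refine h.trans (mul_le_mul' (le_quarter_of_parts (step_factor_le _ _ _ _ _ _ _ hl1) hL ?_) le_rfl)
    exact mul_ofReal_inv_le_of_le (hDtop k) (by norm_num) (hΛk k hk hlam)
  /- ## the outputs -/
  have hsmΘ : ∀ m, IsSmoothSpaceTimeOn (Icc 0 T) (dataIter Q A T S 𝔟 𝔠 Θ m) := isSmoothSpaceTimeOn_dataIter hT hΘ hS h𝔟 h𝔠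
  refine ⟨vNeumann Q A T S 𝔟 𝔠 Θ N, dataIter Q A T S 𝔟 𝔠 Θ N, isSmoothSpaceTimeOn_vNeumann hT hΘ hS h𝔟 h𝔠 N, hsmΘ N,
    fun y ↦ vNeumann_zero _ N y, ?_, ?_, ?_, ?_⟩
  · -- the equation
    intro s hs y
    have hreg : closedBall (0 : E') (ϱ + 5 * N * Q.r) ⊆ Q.region := by rw [hQr']; exact hQreg
    exact timeDerivWithin_vNeumann hT hΘ hS h𝔟 h𝔠 hΘϱ N hreg hs y
  · -- smallness of the residual
    intro k hk s hs
    have hkK : k ≤ K := by omega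
    rw [hN, dataIter_succ]
    have h1 := sobolevEnergy_errOne_le_overlap S 𝔟 𝔠 hT (hsmΘ N₀) hS h𝔟 h𝔠 k
      (hslice k hkK _ (hsmΘ N₀)) (hpush k (by omega)) hΛ0 hs
    have h2 : ∑ i, ∫⁻ σ in Ioo 0 s, ENNReal.ofReal (Real.exp (-2 * Λ * σ)) *
        sobolevEnergy (k + 1) (dataAd Q A (dataIter Q A T S 𝔟 𝔠 Θ N₀) i σ) ≤
        (ENNReal.ofReal 4⁻¹) ^ N₀ * ∑ i, ∫⁻ σ in Ioo 0 s, ENNReal.ofReal (Real.exp (-2 * Λ * σ)) *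
          sobolevEnergy (k + 1) (dataAd Q A Θ i σ) :=
      norm_dataIter_le hT hΘ hS h𝔟 h𝔠 (k + 1) (hstep (k + 1) hk le_rfl hs) N₀
    have h3 : ∑ i, (∫⁻ σ in Ioo 0 s, ENNReal.ofReal (Real.exp (-2 * Λ * σ)) * sobolevEnergy (k + 1) (dataAd Q A Θ i σ)) ≤
        ENNReal.ofReal ((2 * (ϱ + 2 * Q.r) / Q.mesh + 1) ^ Module.finrank ℝ E') * (Cd (k + 1) * CΘ (k + 1) * ENNReal.ofReal T) :=
      sum_lintegral_dataAd_le hϱ hΘϱ (k + 1) (hCd (k + 1) hk Θ hΘ) (hCΘ (k + 1)) hΛ0.le hs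
    rw [hQr', hQmesh] at h1 h3
    have hX : ENNReal.ofReal (Real.exp (2 * Λ * s)) ≤ ENNReal.ofReal (Real.exp (2 * Λ * T)) :=
      ENNReal.ofReal_le_ofReal (Real.exp_le_exp.2 (by nlinarith [hs.2, hΛ0.le]))
    have hΛinv : ENNReal.ofReal Λ⁻¹ ≤ 1 := by
      rw [← ENNReal.ofReal_one]; exact ENNReal.ofReal_le_ofReal (inv_le_one_of_one_le₀ hΛ1)
    have hGk : m₃ * Cpush * (ENNReal.ofReal (Real.exp (2 * Λ * T)) *
        (A₀ * ((n : ℝ≥0∞) * (n : ℝ≥0∞)) + Bk k * ((n : ℝ≥0∞) + 1))) * (cnt * (Cd (k + 1) * CΘ (k + 1) * ENNReal.ofReal T)) ≤ G :=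
      Finset.single_le_sum (f := fun k ↦ m₃ * Cpush * (ENNReal.ofReal (Real.exp (2 * Λ * T)) *
        (A₀ * ((n : ℝ≥0∞) * (n : ℝ≥0∞)) + Bk k * ((n : ℝ≥0∞) + 1))) * (cnt * (Cd (k + 1) * CΘ (k + 1) * ENNReal.ofReal T)))
        (fun _ _ ↦ bot_le) (Finset.mem_range.2 (Nat.lt_of_succ_le hk))
    calc sobolevEnergy k (errOne Q A T S 𝔟 𝔠 (dataIter Q A T S 𝔟 𝔠 Θ N₀) s)
        ≤ m₃ * Cpush * (ENNReal.ofReal (Real.exp (2 * Λ * s)) *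
            (A₀ * ((n : ℝ≥0∞) * (n : ℝ≥0∞)) + Bk k * ((n : ℝ≥0∞) + ENNReal.ofReal Λ⁻¹))) *
          ((ENNReal.ofReal 4⁻¹) ^ N₀ * (cnt * (Cd (k + 1) * CΘ (k + 1) * ENNReal.ofReal T))) :=
          h1.trans (mul_le_mul' le_rfl (h2.trans (mul_le_mul' le_rfl h3)))
      _ ≤ m₃ * Cpush * (ENNReal.ofReal (Real.exp (2 * Λ * T)) *
            (A₀ * ((n : ℝ≥0∞) * (n : ℝ≥0∞)) + Bk k * ((n : ℝ≥0∞) + 1))) *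
          ((ENNReal.ofReal 4⁻¹) ^ N₀ * (cnt * (Cd (k + 1) * CΘ (k + 1) * ENNReal.ofReal T))) := by gcongr
      _ = (ENNReal.ofReal 4⁻¹) ^ N₀ * (m₃ * Cpush * (ENNReal.ofReal (Real.exp (2 * Λ * T)) *
            (A₀ * ((n : ℝ≥0∞) * (n : ℝ≥0∞)) + Bk k * ((n : ℝ≥0∞) + 1))) * (cnt * (Cd (k + 1) * CΘ (k + 1) * ENNReal.ofReal T))) := by
          ring
      _ ≤ (ENNReal.ofReal 4⁻¹) ^ N₀ * G := mul_le_mul' le_rfl hGk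
      _ ≤ ENNReal.ofReal ε := hN₀
  · -- the `λ`-gain bounds
    intro lam hlam k hk t ht
    have hl1 : 1 ≤ lam := hΛ1.trans hlam
    have hl0 : 0 < lam := one_pos.trans_le hl1
    have h1 := lintegral_weight_energy_vNeumann_le S 𝔟 𝔠 hT hΘ hS h𝔟 h𝔠 k (hCcr k) hMv0 (hMvw (k + 1) (by omega))
      (hpush (k + 1) (by omega)) hl0 ht (hstep k hk hlam ht) N
    have h2 := sum_lintegral_dataAd_le_count (Q := Q) (A := A) hΘ hϱ hΘϱ k (hCd k hk Θ hΘ) lam ht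
    rw [hQr', hQmesh] at h1 h2
    have hbox : 16 * Cone k * (cnt * Cd k) ≤ Cbox :=
      Finset.single_le_sum (f := fun k ↦ 16 * Cone k * (cnt * Cd k)) (fun _ _ ↦ bot_le)
        (Finset.mem_range.2 (Nat.lt_succ_of_le hk))
    calc _ ≤ 8 * Cone k * (ENNReal.ofReal (lam⁻¹ / 2) + ENNReal.ofReal (lam⁻¹ ^ 2)) *
          ∑ i, ∫⁻ s in Ioo 0 t, ENNReal.ofReal (Real.exp (-2 * lam * s)) * sobolevEnergy k (dataAd Q A Θ i s) := h1
      _ ≤ 8 * Cone k * (2 * ENNReal.ofReal lam⁻¹) * (cnt * Cd k *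
          ∫⁻ s in Ioo 0 t, ENNReal.ofReal (Real.exp (-2 * lam * s)) * sobolevEnergy k (Θ s)) :=
          mul_le_mul' (mul_le_mul' le_rfl (ofReal_inv_half_add_sq_le hl1)) h2
      _ = 16 * Cone k * (cnt * Cd k) * ENNReal.ofReal lam⁻¹ *
          ∫⁻ s in Ioo 0 t, ENNReal.ofReal (Real.exp (-2 * lam * s)) * sobolevEnergy k (Θ s) := by ring
      _ ≤ Cbox * ENNReal.ofReal lam⁻¹ *
          ∫⁻ s in Ioo 0 t, ENNReal.ofReal (Real.exp (-2 * lam * s)) * sobolevEnergy k (Θ s) := by gcongr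
  · -- the pointwise bounds
    intro lam hlam k hk s hs
    have hl1 : 1 ≤ lam := hΛ1.trans hlam
    have hl0 : 0 < lam := one_pos.trans_le hl1
    have h1 := energy_vNeumann_le_exp S 𝔟 𝔠 hT hΘ hS h𝔟 h𝔠 k (hCcr k) hMv0 (hMvw (k + 1) (by omega))
      (hpush (k + 1) (by omega)) hl0 hs (hstep k hk hlam hs) N
    have h2 := sum_lintegral_dataAd_le_count (Q := Q) (A := A) hΘ hϱ hΘϱ k (hCd k hk Θ hΘ) lam hs
    rw [hQr', hQmesh] at h1 h2
    have hlinv : ENNReal.ofReal lam⁻¹ ≤ 1 := by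
      rw [← ENNReal.ofReal_one]; exact ENNReal.ofReal_le_ofReal (inv_le_one_of_one_le₀ hl1)
    have hsup : 8 * Cone k * ((n : ℝ≥0∞) + 1) * (cnt * Cd k) ≤ Csup :=
      Finset.single_le_sum (f := fun k ↦ 8 * Cone k * ((n : ℝ≥0∞) + 1) * (cnt * Cd k)) (fun _ _ ↦ bot_le)
        (Finset.mem_range.2 (Nat.lt_succ_of_le hk))
    calc _ ≤ ENNReal.ofReal (Real.exp (2 * lam * s)) * (8 * Cone k * ((n : ℝ≥0∞) + ENNReal.ofReal lam⁻¹)) *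
          ∑ i, ∫⁻ σ in Ioo 0 s, ENNReal.ofReal (Real.exp (-2 * lam * σ)) * sobolevEnergy k (dataAd Q A Θ i σ) := h1
      _ ≤ ENNReal.ofReal (Real.exp (2 * lam * s)) * (8 * Cone k * ((n : ℝ≥0∞) + 1)) * (cnt * Cd k *
          ∫⁻ σ in Ioo 0 s, ENNReal.ofReal (Real.exp (-2 * lam * σ)) * sobolevEnergy k (Θ σ)) := by gcongr
      _ = 8 * Cone k * ((n : ℝ≥0∞) + 1) * (cnt * Cd k) * ENNReal.ofReal (Real.exp (2 * lam * s)) *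
          ∫⁻ σ in Ioo 0 s, ENNReal.ofReal (Real.exp (-2 * lam * σ)) * sobolevEnergy k (Θ σ) := by ring
      _ ≤ Csup * ENNReal.ofReal (Real.exp (2 * lam * s)) *
          ∫⁻ σ in Ioo 0 s, ENNReal.ofReal (Real.exp (-2 * lam * σ)) * sobolevEnergy k (Θ σ) := by gcongr

end Literature.Analysis.PDE
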